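import Mathlib.Analysis.Complex.CauchyIntegral
import Literature.MathematicalPhysics.QuantumLattice.GrassmannLinearSubstitution
import Literature.MathematicalPhysics.QuantumFieldTheory.Dimock2011to13.QED3GrassmannNormedAlgebra
import Literature.MathematicalPhysics.QuantumFieldTheory.Dimock2011to13.QED3StabilityBoundAssembly
import HarnessLib

/-!
# Dimock, *Ultraviolet stability for QED in d = 3*, §4.2.3 «fermion integral — small field region», LEMMA 26 (503):
# the proof steps (504)–(510) and (512)–(513) — the perturbation `E*_K = −E′_K + E″_K`, the contour
# representation (508) of `E′_K` and its bound (509) from (507), the bound (510) on `E″_K = E_K(Λ_K, A, H Ψ_K)` by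
# LEMMA 20 of *QED on the 3-torus I* and the polymer expansion (37)∕(38), the change to identity covariance (512) and the
# norm comparison (513) — PROVED on the Grassmann algebra, and LEMMA 26 ASSEMBLED with the closing step (511)–(514)

statement-level skeleton of published theorems with citation tags; proofs where landed; nothing here is a claim about the Yang–Mills mass gap

**Citation header (reproduction of PUBLISHED work).** J. Dimock, *Ultraviolet stability for QED in d = 3*, Ann. Henri
Poincaré **23** (2022) 2113–2205 (= arXiv:2009.01156v2) [Dimock2022UVStabilityQED3], §4.2.3 LEMMA 26 (503) p.69 L1–3 and
its proof (504)–(514) p.69 L4 – p.70 L35, with the inputs it quotes: THEOREM 1 (37)∕(38) p.7 L62–78 (polymer expansion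
and bounds of `E_k`), (327) p.44 L29–32 («`|H_{k,Ω}(A)Γ̃_{k,Ω⁺}(A)f| ≤ C‖f‖_∞`»), LEMMA 22 p.63 L103–105 («every matrix
element satisfies `|C_K(0,x,y)| ≤ C(Mr_K)³`»); all loci `p.NN Lnn` = PDF page ∕ text-layer line of the held arXiv text
`paper:arxiv-2009.01156`.  J. Dimock, *Quantum electrodynamics on the 3-torus. I*, arXiv:math-ph/0210020
[Dimock2002QED3TorusI], App. B LEMMA 20 (303)–(304) p.62 L31 – p.63 L1 («Let `F′(Ψ) = F(AΨ)`. If `h′‖A‖_{(1)} ≤ h`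
then `‖F′‖_{h′} ≤ ‖F‖_h`») and LEMMA 21 (311) p.64 L1–3 — in the tree as `QED3TorusI.hNorm_subst_le`,
`QED3TorusI.norm_gaussExpect_le_hNorm`.  Writer seat p11 (literature-prover-lit-balaban-p11-g26-0), YM LIT SWEEP item (c)
D8 (row C08; zero weight for the YM-INPRINT tokens).  Continues the tree's `QED3SmallFieldFermionRatio` ((511)–(514) in an
abstract Banach algebra), `QED3GrassmannNormedAlgebra` (the same ON the Grassmann algebra `(𝒢, ‖·‖_h)`; `lemma26_closing_grassmann`)
and `QED3FinalCovarianceDeterminant` (LEMMA 22); uses the tree's `QuantumLattice.quadratic` (`ψ̄Aψ = Σ A_{ij}ψ̄_iψ_j`),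
`QuantumLattice.gaussExpect` (`∫·dμ_C`) with `gaussConv_map` (covariance of Gaussian Grassmann integrals under linear
substitutions), and Mathlib's Cauchy integral formula (`DiffContOnCl.two_pi_i_inv_smul_circleIntegral_sub_inv_smul`).

**The printed text (verbatim, text layer).**  p.69 L1–3: *"Lemma 26. For `|dA_K| ≤ p_K` and uniformly in `N`
`Ξ_K(A_K)∕Z_f(N,0) = 1 + O(e_K^{1∕4−8ε})` (503)"*.  p.69 L4–31: *"Proof. `|dA_K| ≤ p_K` implies … `A_K ∈
e_K^{3∕4−4ε}R̃_K` as in (41). So it suffices to study `Ξ_K(A)∕Z_f(N,0)` for `A ∈ e_K^{3∕4−4ε}R̃_K`. We define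
`E′_K(Λ_K, A, Ψ_K) = ⟨Ψ̄_K, D_K(A)Ψ_K⟩ − ⟨Ψ̄_K, D_K(0)Ψ_K⟩`, `E″_K(Λ_K, A, Ψ_K) = E_K(Λ_K, A, H#_K(A)Ψ_K)` (504) and
`E*_K(Λ_K) = −E′_K(Λ_K) + E″_K(Λ_K)`. Then we have `Ξ_K(A) = Z′_K(0)∫DΨ_K exp(−⟨Ψ̄_K,D_K(0)Ψ_K⟩ + E*_K(Λ_K))` (505)"*.
p.69 L45–51: *"Comparing this with (502) we identify a Gaussian integral with covariance `C_K(0) = D_K(0)⁻¹` introduced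
in lemma 22. Then we have `Ξ_K(A)∕Z_f(N,0) = ∫e^{E*_K(Λ_K)}dμ_{C_K(0)}(Ψ_K)` (506)"*.  p.69 L52–70: *"We need estimates
on `E′_K(Λ_K), E″_K(Λ_K)` and so `E*_K(Λ_K)`. For the first we use the representation `D_K(A) = b_K −
b_K²Q_K(A)S_K(A)Q_K^T(−A)`. Using the decay bounds for `S_K(A)` we find for `A ∈ R̃_K`
`‖⟨Ψ̄_K,D_K(A)Ψ_K⟩‖_{h_K} ≤ Ch_K²|Λ_K^{(K)}| = Ch_K²|T⁰_{N−K}|` (507) Indeed this is (439), (441), but with weight `h_K` …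
Or see a similar bound in lemma 20 in [30]. Now we write"*  p.69 L71–96: *"`E′_K(Λ_K, A, Ψ_K) =
(1∕2πi)∫_{|t|=e_K^{−3∕4+4ε}} dt∕(t(t−1)) ⟨Ψ̄_K,D_K(tA)Ψ_K⟩` (508) Then (507) yields the bound `‖E′_K(Λ_K)‖_{h_K} ≤
Ce_K^{3∕4−4ε}h_K²|T⁰_{N−K}| = Ce_K^{1∕4−4ε}|T⁰_{N−K}|` (509)"*.  p.69 L97–110: *"For the second (327) says that there is
a constant `C₀` such that `|H#_K(A)f| ≤ C₀‖f‖_∞`. Hence by our basic estimate (37),(38) `‖E″_K(Λ_K)‖_{C₀⁻¹h_K} ≤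
‖E_K(Λ_K)‖_{h_K} ≤ O(1)e_K^{1∕4−7ε}|T⁰_{N−K}|` (510) This bound is satisfied by `E′_K(Λ_K)` and hence `E*_K(Λ_K)` as
well."*  p.69 L111–137, p.70 L1–17: *"Now we write `Ξ_K(A)∕Z_f(N,0) = 1 + ∫(exp(E*_K(Λ_K)) − 1)dμ_{C_K(0)}(Ψ_K) = … =
1 + ∫₀¹dt∫E**_K(Λ_K)e^{tE**_K(Λ_K)}dμ_I(Ψ_K)` (511) Here in the last step we changed to an identity covariance defining
`E**_K(Λ_K, A, Ψ̄_K, Ψ_K) = E*_K(Λ_K, A, Ψ̄_K, C_K(0)Ψ_K)` (512) As noted in lemma 22 `C_K(0)` has a bounded kernel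
`|C_K(0,x,y)| ≤ C(Mr_K)³` and then `|C_K(0)f| ≤ C(Mr_K)⁶‖f‖_∞`. It follows that `‖E**_K(Λ_K)‖₁ ≤ ‖E*_K(Λ_K)‖_{C(Mr_K)⁶}
≤ ‖E*_K(Λ_K)‖_{C₀⁻¹h_K} ≤ O(1)e_K^{1∕4−7ε}|T⁰_{N−K}|` (513)"*; p.70 L18–35: (514) and *"This implies
`|Ξ_K(A)∕Z_f(N,0) − 1|` is bounded by `O(1)e_K^{1∕4−7ε}|T⁰_{N−K}| ≤ e_K^{1∕4−8ε}` and hence the result"* (in the tree: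
`QED3SmallFieldFermionRatio`, `HGrassmann.lemma26_closing_grassmann`).

**What is formalized (kernel-checked, zero `sorry`, no named facts).**  Generators: the unit-lattice fermions
`Ψ̄_K(x), Ψ_K(x)`, `x ∈ X` (sites × spinor index), generate the tree's `GrassmannAlgebra 𝕜 (X ⊕ₗ X)` (`QuantumLattice.psiBar`,
`psi`; `⟨Ψ̄,DΨ⟩ = QuantumLattice.quadratic 𝕜 D`); the fields `ψ#` of `E_K(X, A, ψ#)` are generators indexed by a second
finite type `κ` (the fine lattice), and `ψ# = H#_K(A)Ψ_K` is a RECTANGULAR substitution matrix `H : Matrix κ (X ⊕ₗ X) 𝕜`.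
* §1 **(508), the mechanism, in any complex Banach space**: `sub_eq_contourIntegral` — `f` complex-differentiable on the
  disc `|t| < R` and continuous on its closure, `R > 1` ⟹ `f(1) − f(0) = (2πi)⁻¹∮_{|t|=R} dt∕(t(t−1)) f(t)` (Cauchy's
  formula at `t = 1` and `t = 0`, `1∕(t(t−1)) = 1∕(t−1) − 1∕t`); `norm_sub_le_of_sphere` — hence `‖f(1) − f(0)‖ ≤
  M∕(R−1)` when `‖f‖ ≤ M` on the circle; `norm_sub_le_two_mul_div` — `≤ 2M∕R` for `R ≥ 2`.
* §2 **(507) from row-sum decay**: `hNorm_quadratic_le` — `‖⟨Ψ̄,DΨ⟩‖_h ≤ h²Σ_{x,y}|D(x,y)|`;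
  `hNorm_quadratic_le_of_rowsum` — `sup_xΣ_y|D(x,y)| ≤ c ⟹ ‖⟨Ψ̄,DΨ⟩‖_h ≤ c·h²·|X|` («using the decay bounds … we
  find `‖⟨Ψ̄_K,D_K(A)Ψ_K⟩‖_{h_K} ≤ Ch_K²|T⁰_{N−K}|`»); `hNorm_mono` — `‖·‖_h` is monotone in `h`.
* §3 **LEMMA 20 of [Dimock2002QED3TorusI] for RECTANGULAR substitutions** (the tree's `QED3TorusI.subst`,
  `opNormOne`, `hNorm_subst_le` are the square case, recovered as `subst_eq_substR`, `opNormOne_eq_opNormOneR`):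
  `substR H : 𝒢_κ →ₐ 𝒢_ι`, `ψ(ζ) ↦ Σ_ξ H ζ ξ Ψ(ξ)` (`substR_gen`); `opNormOneR H = sup_ζ Σ_ξ|H ζ ξ|` (= the constant of
  «`|Hf| ≤ C₀‖f‖_∞`»; `opNormOneR_le_of_rowsum`, `opNormOneR_le_of_entry_le`); **`hNorm_substR_le`**:
  `h′‖H‖_{(1)} ≤ h ⟹ ‖F(HΨ)‖_{h′} ≤ ‖F‖_h`.
* §4 **(504)–(505)**: `ePrime D₁ D₀ = ⟨Ψ̄,D₁Ψ⟩ − ⟨Ψ̄,D₀Ψ⟩`, `eDoublePrime H E = E(HΨ)` (`eDoublePrime_gen`),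
  `eStar = −ePrime + eDoublePrime`; `eq505` — the exponent identity `−⟨Ψ̄,D(A)Ψ⟩ + E″ = −⟨Ψ̄,D(0)Ψ⟩ + E*` behind (505).
* §5 **(508)–(509) for `E′_K`** in the Banach algebra `(𝒢, ‖·‖_h)` (`HGrassmann ℂ (X ⊕ₗ X) h`): for a matrix family
  `t ↦ D(t)` (= `D_K(tA)`) with entries complex-differentiable on `|t| < R`, continuous on `|t| ≤ R`:
  `diffContOnCl_quadratic`, **`ePrime_eq_contour`** = (508) `E′ = (2πi)⁻¹∮_{|t|=R} dt∕(t(t−1)) ⟨Ψ̄,D(t)Ψ⟩`;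
  **`hNorm_ePrime_le`** = (509) from (507) on the circle: `‖E′‖_h ≤ c·h²·|X|∕(R−1)`; `hNorm_ePrime_le_printed` — with
  the printed radius `R = e_K^{−(3∕4−4ε)} ≥ 2`: `‖E′‖_h ≤ 2c·e_K^{3∕4−4ε}·h²·|X|`.
* §6 **(510)**: `hNorm_eDoublePrime_le` — `‖H‖_{(1)} ≤ C₀ ⟹ ‖E″‖_{h_K∕C₀} ≤ ‖E_K(Λ_K)‖_{h_K}` (LEMMA 20);
  `hNorm_polymerSum_le` — (37)∕(38) summed: `‖E_K(X)‖_{h_K} ≤ e_K^{1∕4−7ε}w(X)` for `X ∈ 𝒟`, `Σ_{X∈𝒟}w(X) ≤ K₀T` ⟹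
  `‖Σ_{X∈𝒟}E_K(X)‖_{h_K} ≤ e_K^{1∕4−7ε}K₀T`; **`ineq510`**; and **`hNorm_eStar_le`** («This bound is satisfied by `E′_K`
  and hence `E*_K` as well»): with `h_K = e_K^{−1∕4}`, `e_K ≤ 1`, `ε ≥ 0`, `C₀ ≥ 1`, `|X| ≤ T`:
  `‖E*‖_{h_K∕C₀} ≤ (2c + K₀)·e_K^{1∕4−7ε}·T` (the exponent arithmetic `e_K^{3∕4−4ε}h_K² = e_K^{1∕4−4ε} ≤ e_K^{1∕4−7ε}`).
* §7 **(512)–(513)**: `gaussExpect_subst` — Gaussian Grassmann integrals are covariant under substitutions,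
  `∫F(BΨ)dμ_Γ = ∫F dμ_{BΓBᵀ}` (the tree's `gaussConv_map` read through the constant part); `psiSubst C` — the printed
  substitution «`Ψ̄_K, Ψ_K ↦ Ψ̄_K, C_K(0)Ψ_K`» as a block matrix (`subst_psiSubst_psiBar`, `subst_psiSubst_psi`), with
  `opNormOne_psiSubst_le` (`‖·‖_{(1)} ≤ max(1, ‖C‖_{(1)})`) and `opNormOne_psiSubst_le_of_kernel` («`|C_K(0,x,y)| ≤
  C(Mr_K)³` and then `|C_K(0)f| ≤ C(Mr_K)⁶‖f‖_∞`»: entry bound `b` ⟹ `≤ max(1, b|X|)`); **`ineq513`** —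
  `h₁‖B‖_{(1)} ≤ h′ ≤ h_K∕C₀ ⟹ ‖E*(BΨ)‖_{h₁} ≤ ‖E*‖_{h′} ≤ ‖E*‖_{h_K∕C₀}` (LEMMA 20 + monotonicity; the print has `h₁ = 1`).
* §8 **LEMMA 26 assembled**: `substH_exp` — the substitution commutes with the Banach-algebra exponential (continuity in
  finite dimension); **`eq512`** — `∫e^{E*}dμ_{BΓBᵀ} = ∫e^{E**}dμ_Γ`, `E** = E*(BΨ)`; **`lemma26_of_513`** — for any
  additive functional `μ` with `|μF| ≤ ‖F‖_{h₁}`, `μ1 = 1` (the `∫·dμ_I` of p.61 L57) and `E*` with the bound of §6: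
  `|μ(e^{E**}) − 1| ≤ e_K^{1∕4−8ε}` (via the tree's `lemma26_closing_grassmann`); **`lemma26`** — EVERYTHING CHAINED: from
  the entrywise analyticity of `t ↦ D_K(tA)` on `|t| ≤ e_K^{−3∕4+4ε}` with the row-sum bound (507) on that circle, the
  bounds (38) with the summed tree-decay constant, (327), the substitution bound of (513), D12 LEMMA 21's hypothesis
  `√‖Γ‖₍₂₎ ≤ h₁` for the identity-covariance pairing `Γ`, and the two printed smallness conditions, to
  `|∫e^{E*_K}dμ_{C} − 1| ≤ e_K^{1∕4−8ε}` where `∫·dμ_C := gaussExpect (BΓBᵀ)`, `B = psiSubst C_K(0)`.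

**Readings (declared).**  (i) «analytic in `A ∈ R̃_K`» along the ray `tA`, `|t| ≤ e_K^{−3∕4+4ε}`, is read as: each
matrix entry of `t ↦ D_K(tA)` is complex-differentiable on the open disc and continuous on the closed disc
(`DiffContOnCl`), which is what the contour (508) ON the circle `|t| = e_K^{−3∕4+4ε}` requires; (507) is used on that
circle.  (ii) The decay input of (507) («the decay bounds for `S_K(A)`», (439)∕(441)) enters as the row-sum hypothesis
`sup_x Σ_y |D_K(tA)(x,y)| ≤ c`; (327) as `‖H‖_{(1)} ≤ C₀`; (37)∕(38) as per-polymer bounds with weights `w(X)`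
(= `e^{−κd_M(X)}`) and the summed tree-decay constant `Σ_{X⊂Λ_K} w(X) ≤ K₀|T⁰_{N−K}|`; the `O(1)` of (510)∕(513) is the
explicit `2c + K₀`, and the two «sufficiently small» uses are the explicit hypotheses of `lemma26_closing_grassmann`.
(iii) (506) — the identification of the ratio `Ξ_K(A)∕Z_f(N,0)` with a normalized Gaussian Grassmann integral — is the
DEFINITION of `∫·dμ_{C_K(0)}`; here `∫·dμ_C` is the tree's `gaussExpect` for the pairing `BΓBᵀ` obtained from an
identity-covariance pairing `Γ` by the printed substitution `B` (so that (512) holds by `gaussExpect_subst`), and LEMMA 21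
of [Dimock2002QED3TorusI] (`√‖Γ‖₍₂₎ ≤ h₁`) supplies «`|∫f dμ_I| ≤ ‖f‖₁`»; the print has `h₁ = 1`.  (iv) `|X| ≤ T`
(`T = |T⁰_{N−K}|` up to the spinor multiplicity absorbed in the constants).  (v) The exponential `e^{E*}` is Mathlib's
`NormedSpace.exp` in the Banach algebra `(𝒢, ‖·‖_{h₁})` (cf. `HGrassmann.exp_eq_grassmannExp`).

**Honest scope.**  Finite-dimensional Grassmann-algebra estimates, one-variable Cauchy theory and bookkeeping only; the
operators `D_K(A)`, `H#_K(A)`, `C_K(0)`, the activities `E_K(X)` and the regions are NOT constructed — they enter through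
the hypotheses named above, exactly the inputs the printed proof quotes.  No `d = 4` statement; nothing about Bałaban's
papers.
**v1.1 (APPEND-ONLY; §§1–8 byte-identical) — the unit Gaussian `dμ_I` made concrete.**  §9 adds: `isBar` (the charge of a
label: `Ψ̄` vs `Ψ`), **`unitPairing`** — the identity-covariance pairing of (511)∕(512) («`dμ_I(Ψ_K)`»: `∫Ψ(y)Ψ̄(x̄)dμ_I =
δ(y,x̄)`, no `ΨΨ`∕`Ψ̄Ψ̄` pairing) as a matrix on `X ⊕ₗ X`, `unitPairing_charge` (D12 LEMMA 21's charge condition),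
`contr_unitPairing_inr`, `sum_sq_contr_unitPairing_inr` (each `Ψ`-row of the two-point function has exactly one entry,
`= 1`), `twoNormSq_unitPairing_le`, **`sqrt_twoNorm_unitPairing_le_one`** («`‖Γ‖₍₂₎`» of (310) is `≤ 1`, so D12 LEMMA 21
gives «`|∫f(Ψ)dμ_I(Ψ)| ≤ ‖f‖₁`», p.61 L57), and **`lemma26_unit`** = `lemma26` with `Γ = dμ_I`, `h₁ = 1` — the two
hypotheses `hΓq`, `hΓ` of `lemma26` DISCHARGED; the `C_K(0)`-covariance integral of (506) is then `gaussExpect` of the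
pairing `B·Γ_I·Bᵀ`, `B = psiSubst C_K(0)`.  §10 adds the ROW-SUM INPUT of (507) from the printed representation
«`D_K(A) = b_K − b_K²Q_K(A)S_K(A)Q_K^T(−A)`. Using the decay bounds for `S_K(A)` …» (p.69 L52–58): `rowsum_mul_le`
(row sums of a product), `opNormOneR_le_of_decay` (kernel decay `|S(x,y)| ≤ C·wt(x,y)` with `Σ_ywt(x,y) ≤ K₀` ⟹
`‖S‖_{(1)} ≤ CK₀`), **`rowsum_rep_le`** (`Σ_y|D(x,y)| ≤ |b| + |b|²(Σ_k|Q(x,k)|)‖S‖_{(1)}‖Qᵗ‖_{(1)}` for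
`D = b·1 − b²QSQᵗ`) and `h507_of_decay` (hence the constant `c` of `hNorm_quadratic_le_of_rowsum`∕`lemma26`).  §11:
**`lemma27_with_lemma26`** — LEMMA 26's output IS the second factor `h26` of the tree's `QED3StabilityAssembly.lemma27_assembled`
((519): «the second factor is `1 + O(e_K^{1∕4−8ε})` by lemma 26»), so (518) follows with `δ₂ = e_K^{1∕4−8ε}` (one import
added: `QED3StabilityBoundAssembly`).  Writer seat p11 (literature-prover-lit-balaban-p11-g26-0).
-/

noncomputable section

open Finset Complex MeasureTheory Metric Set

namespace Literature.MathematicalPhysics.QuantumFieldTheory.Dimock2011to13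

namespace QED3SmallFieldFermion

open Literature.MathematicalPhysics.QuantumLattice
open Literature.MathematicalPhysics.QuantumLattice.GrassmannAlgebra
open QED3TorusI HGrassmann

/-! ## §1 (508), the mechanism: `f(1) − f(0)` as a contour integral, in any complex Banach space -/

section Contour

variable {F : Type*} [NormedAddCommGroup F] [NormedSpace ℂ F] [CompleteSpace F]

/-- **(508), the mechanism.**  For `f` complex-differentiable on the disc `|t| < R` and continuous on `|t| ≤ R`, `R > 1`:
`f(1) − f(0) = (2πi)⁻¹ ∮_{|t|=R} dt∕(t(t−1)) f(t)` — Cauchy's integral formula at `t = 1` and at `t = 0` and the partial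
fractions `1∕(t(t−1)) = 1∕(t−1) − 1∕t`.
[cite: Dimock2022UVStabilityQED3, §4.2.3 Lemma 26 proof (508) p.69 L71–84] -/
theorem sub_eq_contourIntegral {f : ℂ → F} {R : ℝ} (hR : 1 < R) (hf : DiffContOnCl ℂ f (ball 0 R)) :
    f 1 - f 0 = (2 * Real.pi * I : ℂ)⁻¹ • ∮ z in C(0, R), (z * (z - 1))⁻¹ • f z := by
  have h1 : (1 : ℂ) ∈ ball (0 : ℂ) R := by simp [hR]
  have h0 : (0 : ℂ) ∈ ball (0 : ℂ) R := by simp; linarith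
  have e1 := hf.two_pi_i_inv_smul_circleIntegral_sub_inv_smul h1
  have e0 := hf.two_pi_i_inv_smul_circleIntegral_sub_inv_smul h0
  have hR0 : 0 ≤ R := by linarith
  have hsph : ∀ z ∈ sphere (0:ℂ) R, z ≠ 0 ∧ z - 1 ≠ 0 := by
    intro z hz
    have hzR : ‖z‖ = R := by simpa using hz
    refine ⟨fun h => ?_, fun h => ?_⟩
    · rw [h, norm_zero] at hzR; linarith
    · rw [sub_eq_zero.mp h, norm_one] at hzR; linarith
  have hker : ∀ z ∈ sphere (0:ℂ) R, (z * (z - 1))⁻¹ • f z = (z - 1)⁻¹ • f z - (z - 0)⁻¹ • f z := by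
    intro z hz
    obtain ⟨hz0, hz1⟩ := hsph z hz
    rw [sub_zero, ← sub_smul]
    congr 1
    field_simp
    ring
  have hcont : ContinuousOn f (sphere (0:ℂ) R) := hf.continuousOn.mono (by
    rw [closure_ball (0:ℂ) (by linarith : R ≠ 0)]
    exact sphere_subset_closedBall)
  have hc1 : CircleIntegrable (fun z => (z - 1)⁻¹ • f z) 0 R := by
    refine ContinuousOn.circleIntegrable hR0 (ContinuousOn.smul ?_ hcont)
    exact ContinuousOn.inv₀ (continuousOn_id.sub continuousOn_const) fun z hz => (hsph z hz).2
  have hc0 : CircleIntegrable (fun z => (z - 0)⁻¹ • f z) 0 R := by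
    refine ContinuousOn.circleIntegrable hR0 (ContinuousOn.smul ?_ hcont)
    refine ContinuousOn.inv₀ (continuousOn_id.sub continuousOn_const) fun z hz => ?_
    rw [sub_zero]; exact (hsph z hz).1
  have hint : (∮ z in C(0, R), (z * (z - 1))⁻¹ • f z)
      = (∮ z in C(0, R), (z - 1)⁻¹ • f z) - ∮ z in C(0, R), (z - 0)⁻¹ • f z := by
    rw [← circleIntegral.integral_sub hc1 hc0]
    exact circleIntegral.integral_congr hR0 fun z hz => hker z hz
  rw [hint, smul_sub, e1, e0]

/-- **(509), the mechanism.**  If moreover `‖f(t)‖ ≤ M` on the circle `|t| = R` then `‖f(1) − f(0)‖ ≤ M∕(R − 1)`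
(`|t(t−1)| ≥ R(R−1)` on the circle, length `2πR`).
[cite: Dimock2022UVStabilityQED3, §4.2.3 Lemma 26 proof (508)–(509) p.69 L71–96] -/
theorem norm_sub_le_of_sphere {f : ℂ → F} {R M : ℝ} (hR : 1 < R) (hf : DiffContOnCl ℂ f (ball 0 R))
    (hM : ∀ z ∈ sphere (0 : ℂ) R, ‖f z‖ ≤ M) : ‖f 1 - f 0‖ ≤ M / (R - 1) := by
  rw [sub_eq_contourIntegral hR hf]
  have hR0 : 0 ≤ R := by linarith
  have hb : ∀ z ∈ sphere (0 : ℂ) R, ‖(z * (z - 1))⁻¹ • f z‖ ≤ M / (R * (R - 1)) := by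
    intro z hz
    have hzR : ‖z‖ = R := by simpa using hz
    have hden : R * (R - 1) ≤ ‖z * (z - 1)‖ := by
      rw [norm_mul, hzR]
      refine mul_le_mul_of_nonneg_left ?_ hR0
      calc R - 1 = ‖z‖ - ‖(1:ℂ)‖ := by rw [hzR, norm_one]
        _ ≤ ‖z - 1‖ := norm_sub_norm_le _ _
    have hpos : 0 < R * (R - 1) := mul_pos (by linarith) (by linarith)
    rw [norm_smul, norm_inv]
    calc ‖z * (z - 1)‖⁻¹ * ‖f z‖ ≤ (R * (R - 1))⁻¹ * M :=
          mul_le_mul (inv_anti₀ hpos hden) (hM z hz) (norm_nonneg _) (by positivity)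
      _ = M / (R * (R - 1)) := by rw [div_eq_inv_mul]
  calc ‖(2 * Real.pi * I : ℂ)⁻¹ • ∮ z in C(0, R), (z * (z - 1))⁻¹ • f z‖ ≤ R * (M / (R * (R - 1))) :=
        circleIntegral.norm_two_pi_i_inv_smul_integral_le_of_norm_le_const hR0 hb
    _ = M / (R - 1) := by
        have : R ≠ 0 := by linarith
        field_simp

/-- For a large radius, `R ≥ 2`: `‖f(1) − f(0)‖ ≤ 2M∕R` — the printed shape of (509), `R = e_K^{−3∕4+4ε}` giving the
factor `e_K^{3∕4−4ε}`. [cite: Dimock2022UVStabilityQED3, §4.2.3 Lemma 26 proof (509) p.69 L85–96] -/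
theorem norm_sub_le_two_mul_div {f : ℂ → F} {R M : ℝ} (hR : 2 ≤ R) (hf : DiffContOnCl ℂ f (ball 0 R))
    (hM : ∀ z ∈ sphere (0 : ℂ) R, ‖f z‖ ≤ M) : ‖f 1 - f 0‖ ≤ 2 * M / R := by
  have hR1 : 1 < R := by linarith
  refine (norm_sub_le_of_sphere hR1 hf hM).trans ?_
  have hM0 : 0 ≤ M := by
    have hz : ((R:ℝ):ℂ) ∈ sphere (0:ℂ) R := by simp; linarith
    exact (norm_nonneg _).trans (hM _ hz)
  rw [div_le_div_iff₀ (by linarith) (by linarith)]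
  nlinarith

end Contour

/-! ## §2 The norm side: monotonicity of `‖·‖_h` in `h`, and (507) for the quadratic form `⟨Ψ̄, DΨ⟩` -/

section Norms

variable {𝕜 : Type*} [RCLike 𝕜] {ι : Type*} [LinearOrder ι] [Fintype ι]

/-- `‖F‖_h ≤ ‖F‖_{h′}` for `0 ≤ h ≤ h′` (each monomial weight `h^{#S}` is monotone) — used in «this bound is satisfied by
`E′_K(Λ_K)`» (`‖·‖_{C₀⁻¹h_K} ≤ ‖·‖_{h_K}`) and in the middle inequality of (513).
[cite: Dimock2022UVStabilityQED3, §4.2.3 Lemma 26 proof (510) p.69 L108–110, (513) p.70 L8–17] -/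
theorem hNorm_mono {h h' : ℝ} (hh : 0 ≤ h) (hle : h ≤ h') (F : GrassmannAlgebra 𝕜 ι) :
    hNorm h F ≤ hNorm h' F := by
  unfold hNorm
  exact Finset.sum_le_sum fun S _ =>
    mul_le_mul_of_nonneg_right (pow_le_pow_left₀ hh hle _) (norm_nonneg _)

/-- One term of `⟨Ψ̄,DΨ⟩`: `‖Ψ(ξ)Ψ(ξ′)‖_h ≤ h²` (LEMMA 19 and `‖Ψ(ξ)‖_h = h`).
[cite: Dimock2022UVStabilityQED3, §4.2.3 Lemma 26 proof (507) p.69 L59–67; Dimock2002QED3TorusI, App. B Lemma 19 p.62 L14–24] -/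
theorem hNorm_gen_mul_gen_le {h : ℝ} (hh : 0 ≤ h) (ξ ξ' : ι) :
    hNorm h (gen 𝕜 ξ * gen 𝕜 ξ' : GrassmannAlgebra 𝕜 ι) ≤ h ^ 2 := by
  calc hNorm h (gen 𝕜 ξ * gen 𝕜 ξ' : GrassmannAlgebra 𝕜 ι) ≤ hNorm h (gen 𝕜 ξ : GrassmannAlgebra 𝕜 ι) *
        hNorm h (gen 𝕜 ξ' : GrassmannAlgebra 𝕜 ι) := hNorm_mul_le hh _ _
    _ = h ^ 2 := by rw [hNorm_gen, hNorm_gen, sq]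

variable {X : Type*} [LinearOrder X] [Fintype X]

/-- `‖⟨Ψ̄,DΨ⟩‖_h ≤ h² Σ_{x,y} |D(x,y)|` for the quadratic form `⟨Ψ̄,DΨ⟩ = Σ_{x,y} D(x,y)Ψ̄(x)Ψ(y)` (the tree's
`QuantumLattice.quadratic`; in fact an equality, the bound is what (507) uses).
[cite: Dimock2022UVStabilityQED3, §4.2.3 Lemma 26 proof (507) p.69 L52–67] -/
theorem hNorm_quadratic_le {h : ℝ} (hh : 0 ≤ h) (D : Matrix X X 𝕜) :
    hNorm h (quadratic 𝕜 D : GrassmannAlgebra 𝕜 (X ⊕ₗ X)) ≤ h ^ 2 * ∑ x, ∑ y, ‖D x y‖ := by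
  unfold quadratic
  refine (hNorm_sum_le hh _ _).trans ?_
  rw [Finset.mul_sum]
  refine Finset.sum_le_sum fun x _ => ?_
  refine (hNorm_sum_le hh _ _).trans ?_
  rw [Finset.mul_sum]
  refine Finset.sum_le_sum fun y _ => ?_
  rw [hNorm_smul, mul_comm]
  exact mul_le_mul_of_nonneg_right (hNorm_gen_mul_gen_le hh _ _) (norm_nonneg _)

/-- **(507) from decay.**  A row-sum («decay») bound `sup_x Σ_y |D(x,y)| ≤ c` on the kernel gives
`‖⟨Ψ̄,DΨ⟩‖_h ≤ c·h²·|X|` — «using the decay bounds for `S_K(A)` we find … `‖⟨Ψ̄_K,D_K(A)Ψ_K⟩‖_{h_K} ≤ Ch_K²|T⁰_{N−K}|`».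
[cite: Dimock2022UVStabilityQED3, §4.2.3 Lemma 26 proof (507) p.69 L52–70] -/
theorem hNorm_quadratic_le_of_rowsum {h c : ℝ} (hh : 0 ≤ h) (D : Matrix X X 𝕜)
    (hrow : ∀ x, ∑ y, ‖D x y‖ ≤ c) :
    hNorm h (quadratic 𝕜 D : GrassmannAlgebra 𝕜 (X ⊕ₗ X)) ≤ c * h ^ 2 * Fintype.card X := by
  refine (hNorm_quadratic_le hh D).trans ?_
  calc h ^ 2 * ∑ x, ∑ y, ‖D x y‖ ≤ h ^ 2 * ∑ _x : X, c :=
        mul_le_mul_of_nonneg_left (Finset.sum_le_sum fun x _ => hrow x) (pow_nonneg hh _)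
    _ = c * h ^ 2 * Fintype.card X := by
        rw [Finset.sum_const, Finset.card_univ, nsmul_eq_mul]; ring

/-! ## §3 Rectangular substitutions `ψ = HΨ` and LEMMA 20 of *QED on the 3-torus I* for them (the input of (510)) -/

variable {κ : Type*} [LinearOrder κ] [Fintype κ]

/-- **The substitution `F ↦ F(HΨ)`** from generators `ψ(ζ)`, `ζ ∈ κ` (fine lattice), to generators `Ψ(ξ)`, `ξ ∈ ι` (unit
lattice): `ψ(ζ) = Σ_ξ H ζ ξ Ψ(ξ)` — the algebra homomorphism `𝒢_κ → 𝒢_ι` induced by `Hᵀ` on coordinate vectors (the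
tree's `QED3TorusI.subst` is the square case `κ = ι`).  This is the `Ψ_K ↦ H#_K(A)Ψ_K` of (504).
[cite: Dimock2022UVStabilityQED3, §4.2.3 Lemma 26 proof (504) p.69 L15–27; Dimock2002QED3TorusI, App. B Lemma 20 p.62 L25–32] -/
def substR (H : Matrix κ ι 𝕜) : GrassmannAlgebra 𝕜 κ →ₐ[𝕜] GrassmannAlgebra 𝕜 ι :=
  ExteriorAlgebra.map (Matrix.toLin' H.transpose)

/-- On generators: `ψ(ζ) ↦ Σ_ξ H ζ ξ Ψ(ξ)`. [cite: Dimock2002QED3TorusI, App. B p.62 L25–27 («`(AΨ)(ξ) = Σ A(ξ,ξ′)Ψ(ξ′)`»)] -/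
theorem substR_gen (H : Matrix κ ι 𝕜) (ζ : κ) : substR H (gen 𝕜 ζ) = ∑ ξ, H ζ ξ • gen 𝕜 ξ := by
  rw [substR, gen, ExteriorAlgebra.map_apply_ι, ι_eq_sum_gen]
  refine Finset.sum_congr rfl fun ξ _ => ?_
  rw [Matrix.toLin'_apply, Matrix.mulVec_single_one]
  rfl

/-- `‖H‖_{(1)} = sup_ζ Σ_ξ |H ζ ξ|` for a rectangular kernel — the best constant in «`|Hf| ≤ C₀‖f‖_∞`» ((327)); the
tree's `QED3TorusI.opNormOne` is the square case ((302) of [Dimock2002QED3TorusI]).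
[cite: Dimock2022UVStabilityQED3, §4.2.3 Lemma 26 proof p.69 L97–99; Dimock2002QED3TorusI, App. B (302) p.62 L27–30] -/
def opNormOneR (H : Matrix κ ι 𝕜) : ℝ := ⨆ ζ, ∑ ξ, ‖H ζ ξ‖

omit [LinearOrder κ] [LinearOrder ι] in
/-- Each row sum is below `‖H‖_{(1)}`. [cite: Dimock2002QED3TorusI, App. B (302) p.62 L27–30] -/
theorem sum_norm_le_opNormOneR (H : Matrix κ ι 𝕜) (ζ : κ) : ∑ ξ, ‖H ζ ξ‖ ≤ opNormOneR H :=
  le_ciSup (f := fun ζ => ∑ ξ, ‖H ζ ξ‖) (Set.finite_range _).bddAbove ζ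

omit [LinearOrder κ] [LinearOrder ι] in
/-- `‖H‖_{(1)} ≥ 0`. [cite: Dimock2002QED3TorusI, App. B (302) p.62 L27–30] -/
theorem opNormOneR_nonneg (H : Matrix κ ι 𝕜) : 0 ≤ opNormOneR H := by
  rcases isEmpty_or_nonempty κ with hκ | hκ
  · simp [opNormOneR]
  · exact le_ciSup_of_le (Set.finite_range _).bddAbove (Classical.arbitrary κ)
      (Finset.sum_nonneg fun _ _ => norm_nonneg _)

omit [LinearOrder κ] [LinearOrder ι] [Fintype κ] in
/-- A uniform row-sum bound `C₀ ≥ 0` bounds `‖H‖_{(1)}` — how «there is a constant `C₀` such that `|H#_K(A)f| ≤ C₀‖f‖_∞`»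
enters. [cite: Dimock2022UVStabilityQED3, §4.2.3 Lemma 26 proof p.69 L97–99, (327) p.44 L29–32] -/
theorem opNormOneR_le_of_rowsum (H : Matrix κ ι 𝕜) {C₀ : ℝ} (h0 : 0 ≤ C₀) (hH : ∀ ζ, ∑ ξ, ‖H ζ ξ‖ ≤ C₀) :
    opNormOneR H ≤ C₀ := by
  rcases isEmpty_or_nonempty κ with hκ | hκ
  · simp only [opNormOneR, Real.iSup_of_isEmpty]; exact h0
  · exact ciSup_le hH

omit [LinearOrder κ] [LinearOrder ι] [Fintype κ] in
/-- An entry («bounded kernel») bound `|H ζ ξ| ≤ b` gives `‖H‖_{(1)} ≤ b·|ι|` — the step «`|C_K(0,x,y)| ≤ C(Mr_K)³` and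
then `|C_K(0)f| ≤ C(Mr_K)⁶‖f‖_∞`». [cite: Dimock2022UVStabilityQED3, §4.2.3 Lemma 26 proof p.70 L5–7] -/
theorem opNormOneR_le_of_entry_le (H : Matrix κ ι 𝕜) {b : ℝ} (hb : 0 ≤ b) (hH : ∀ ζ ξ, ‖H ζ ξ‖ ≤ b) :
    opNormOneR H ≤ b * Fintype.card ι := by
  refine opNormOneR_le_of_rowsum H (by positivity) fun ζ => ?_
  calc ∑ ξ, ‖H ζ ξ‖ ≤ ∑ _ξ : ι, b := Finset.sum_le_sum fun ξ _ => hH ζ ξ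
    _ = b * Fintype.card ι := by rw [Finset.sum_const, Finset.card_univ, nsmul_eq_mul, mul_comm]

/-- The substituted generator: `‖(HΨ)(ζ)‖_{h′} ≤ h′‖H‖_{(1)}` — the degree-one case of (304).
[cite: Dimock2002QED3TorusI, App. B (304) p.62 L33–36] -/
theorem hNorm_substR_gen_le {h' : ℝ} (hh' : 0 ≤ h') (H : Matrix κ ι 𝕜) (ζ : κ) :
    hNorm h' (substR H (gen 𝕜 ζ)) ≤ h' * opNormOneR H := by
  rw [substR_gen]
  refine (hNorm_sum_le hh' _ _).trans ?_
  simp only [hNorm_smul, hNorm_gen]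
  rw [← Finset.sum_mul, mul_comm]
  exact mul_le_mul_of_nonneg_left (sum_norm_le_opNormOneR H ζ) hh'

/-- The substituted monomial: `‖θ_S(HΨ)‖_{h′} ≤ (h′‖H‖_{(1)})^{#S}` — (304) «`‖f′_r‖ ≤ (‖A‖_{(1)})^r‖f_r‖`» for a monomial,
by LEMMA 19 along the increasing product. [cite: Dimock2002QED3TorusI, App. B (304) p.62 L33 – p.63 L1] -/
theorem hNorm_substR_grassmannBasis_le {h' : ℝ} (hh' : 0 ≤ h') (H : Matrix κ ι 𝕜) (S : Finset κ) :
    hNorm h' (substR H (grassmannBasis 𝕜 κ S)) ≤ (h' * opNormOneR H) ^ S.card := by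
  induction S using Finset.induction_on_min with
  | empty => simp [hNorm_one]
  | insert a u hmin ih =>
    have hau : a ∉ u := fun h => lt_irrefl a (hmin a h)
    rw [grassmannBasis_insert_of_forall_lt 𝕜 hmin, map_mul, Finset.card_insert_of_notMem hau, pow_succ, mul_comm]
    refine (hNorm_mul_le hh' _ _).trans ?_
    exact mul_le_mul (hNorm_substR_gen_le hh' H a) ih (hNorm_nonneg hh' _)
      (mul_nonneg hh' (opNormOneR_nonneg H))

/-- **LEMMA 20 of [Dimock2002QED3TorusI] for a rectangular substitution** — «If `h′‖A‖_{(1)} ≤ h` then `‖F′‖_{h′} ≤ ‖F‖_h`»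
(303), `F′(Ψ) = F(HΨ)`: the «basic estimate» that turns `|Hf| ≤ C₀‖f‖_∞` into `‖E(HΨ)‖_{C₀⁻¹h} ≤ ‖E‖_h` in (510).
[cite: Dimock2002QED3TorusI, App. B Lemma 20 (303)–(304) p.62 L31 – p.63 L1; Dimock2022UVStabilityQED3, §4.2.3 Lemma 26 proof (510) p.69 L97–107] -/
theorem hNorm_substR_le {h h' : ℝ} (hh' : 0 ≤ h') (H : Matrix κ ι 𝕜) (hH : h' * opNormOneR H ≤ h)
    (F : GrassmannAlgebra 𝕜 κ) : hNorm h' (substR H F) ≤ hNorm h F := by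
  have hF : F = ∑ S, coeff F S • grassmannBasis 𝕜 κ S := ((grassmannBasis 𝕜 κ).sum_repr F).symm
  have hq : 0 ≤ h' * opNormOneR H := mul_nonneg hh' (opNormOneR_nonneg H)
  conv_lhs => rw [hF]
  rw [map_sum]
  refine (hNorm_sum_le hh' _ _).trans ?_
  rw [hNorm]
  refine Finset.sum_le_sum fun S _ => ?_
  rw [map_smul, hNorm_smul, mul_comm]
  refine mul_le_mul_of_nonneg_right ?_ (norm_nonneg _)
  exact (hNorm_substR_grassmannBasis_le hh' H S).trans (pow_le_pow_left₀ hq hH _)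

/-- The tree's square substitution `QED3TorusI.subst` IS `substR` with `κ = ι`. [cite: Dimock2002QED3TorusI, App. B Lemma 20 p.62 L25–32] -/
theorem subst_eq_substR (B : Matrix ι ι 𝕜) : subst B = substR B := rfl

omit [LinearOrder ι] in
/-- … and `QED3TorusI.opNormOne = opNormOneR` in the square case. [cite: Dimock2002QED3TorusI, App. B (302) p.62 L27–30] -/
theorem opNormOne_eq_opNormOneR (B : Matrix ι ι 𝕜) : opNormOne B = opNormOneR B := rfl

/-! ## §4 (504)–(505): the perturbation `E*_K = −E′_K + E″_K` -/

/-- **(504), first line**: `E′_K(Λ_K, A, Ψ_K) = ⟨Ψ̄_K, D_K(A)Ψ_K⟩ − ⟨Ψ̄_K, D_K(0)Ψ_K⟩` — for the two kernels `D₁ = D_K(A)`,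
`D₀ = D_K(0)` on the unit-lattice fermion labels `X`, in the Grassmann algebra generated by `Ψ̄_K, Ψ_K`
(`⟨Ψ̄,DΨ⟩` = the tree's `QuantumLattice.quadratic`). [cite: Dimock2022UVStabilityQED3, §4.2.3 Lemma 26 proof (504) p.69 L15–23] -/
def ePrime (D₁ D₀ : Matrix X X 𝕜) : GrassmannAlgebra 𝕜 (X ⊕ₗ X) := quadratic 𝕜 D₁ - quadratic 𝕜 D₀

/-- **(504), second line**: `E″_K(Λ_K, A, Ψ_K) = E_K(Λ_K, A, H#_K(A)Ψ_K)` — the element `E_Λ = E_K(Λ_K, A, ψ#)` of the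
fine-lattice Grassmann algebra `𝒢_κ` with its generators substituted by `ψ# = HΨ`, `H : Matrix κ (X ⊕ₗ X) 𝕜`.
[cite: Dimock2022UVStabilityQED3, §4.2.3 Lemma 26 proof (504) p.69 L24–27] -/
def eDoublePrime (H : Matrix κ (X ⊕ₗ X) 𝕜) (EΛ : GrassmannAlgebra 𝕜 κ) : GrassmannAlgebra 𝕜 (X ⊕ₗ X) :=
  substR H EΛ

/-- **(504), third line**: `E*_K(Λ_K) = −E′_K(Λ_K) + E″_K(Λ_K)`. [cite: Dimock2022UVStabilityQED3, §4.2.3 Lemma 26 proof p.69 L28–31] -/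
def eStar (D₁ D₀ : Matrix X X 𝕜) (H : Matrix κ (X ⊕ₗ X) 𝕜) (EΛ : GrassmannAlgebra 𝕜 κ) :
    GrassmannAlgebra 𝕜 (X ⊕ₗ X) :=
  -ePrime D₁ D₀ + eDoublePrime H EΛ

/-- Unfolding `E′`. [cite: Dimock2022UVStabilityQED3, §4.2.3 Lemma 26 proof (504) p.69 L15–23] -/
theorem ePrime_def (D₁ D₀ : Matrix X X 𝕜) : ePrime D₁ D₀ = quadratic 𝕜 D₁ - quadratic 𝕜 D₀ := rfl

omit [LinearOrder X] [Fintype X] in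
/-- Unfolding `E″`. [cite: Dimock2022UVStabilityQED3, §4.2.3 Lemma 26 proof (504) p.69 L24–27] -/
theorem eDoublePrime_def (H : Matrix κ (X ⊕ₗ X) 𝕜) (EΛ : GrassmannAlgebra 𝕜 κ) :
    eDoublePrime H EΛ = substR H EΛ := rfl

/-- Unfolding `E*`. [cite: Dimock2022UVStabilityQED3, §4.2.3 Lemma 26 proof p.69 L28–31] -/
theorem eStar_def (D₁ D₀ : Matrix X X 𝕜) (H : Matrix κ (X ⊕ₗ X) 𝕜) (EΛ : GrassmannAlgebra 𝕜 κ) :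
    eStar D₁ D₀ H EΛ = -ePrime D₁ D₀ + eDoublePrime H EΛ := rfl

/-- **(505), the exponent identity**: `−⟨Ψ̄_K,D_K(A)Ψ_K⟩ + E″_K = −⟨Ψ̄_K,D_K(0)Ψ_K⟩ + E*_K` — so that
`Ξ_K(A) = Z′_K(0)∫DΨ_K exp(−⟨Ψ̄_K,D_K(0)Ψ_K⟩ + E*_K(Λ_K))`.
[cite: Dimock2022UVStabilityQED3, §4.2.3 Lemma 26 proof (501), (504)–(505) p.68 L99–111, p.69 L15–44] -/
theorem eq505 (D₁ D₀ : Matrix X X 𝕜) (H : Matrix κ (X ⊕ₗ X) 𝕜) (EΛ : GrassmannAlgebra 𝕜 κ) :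
    -quadratic 𝕜 D₁ + eDoublePrime H EΛ = -quadratic 𝕜 D₀ + eStar D₁ D₀ H EΛ := by
  rw [eStar, ePrime]; abel

/-- `E″` on a generator: `ψ(ζ) ↦ Σ_ξ H ζ ξ Ψ(ξ)` — it IS the evaluation `E_K(Λ_K, A, HΨ_K)`.
[cite: Dimock2022UVStabilityQED3, §4.2.3 Lemma 26 proof (504) p.69 L24–27] -/
theorem eDoublePrime_gen (H : Matrix κ (X ⊕ₗ X) 𝕜) (ζ : κ) :
    eDoublePrime H (gen 𝕜 ζ) = ∑ ξ, H ζ ξ • gen 𝕜 ξ := substR_gen H ζ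

end Norms

/-! ## §5 (508)–(509): the contour representation of `E′_K` in the Banach algebra `(𝒢, ‖·‖_h)` and its bound from (507) -/

section EPrime

/-- Finite sums of functions complex-differentiable on `U` and continuous on its closure are such.
[cite: Dimock2022UVStabilityQED3, §4.2.3 Lemma 26 proof (508) p.69 L71–84] -/
theorem diffContOnCl_finset_sum {E F : Type*} [NormedAddCommGroup E] [NormedSpace ℂ E] [NormedAddCommGroup F]
    [NormedSpace ℂ F] {α : Type*} (s : Finset α) {f : α → E → F} {U : Set E}
    (hf : ∀ a ∈ s, DiffContOnCl ℂ (f a) U) : DiffContOnCl ℂ (fun z => ∑ a ∈ s, f a z) U := by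
  classical
  induction s using Finset.induction_on with
  | empty => simp only [Finset.sum_empty]; exact diffContOnCl_const
  | insert a s ha ih =>
    simp only [Finset.sum_insert ha]
    exact (hf a (Finset.mem_insert_self a s)).add (ih fun b hb => hf b (Finset.mem_insert_of_mem hb))

variable {X : Type*} [LinearOrder X] [Fintype X] {h : ℝ}

/-- `⟨Ψ̄,DΨ⟩` regarded in `(𝒢, ‖·‖_h)` is the finite sum `Σ_{x,y} D(x,y)·Ψ̄(x)Ψ(y)` of fixed vectors with scalar
coefficients. [cite: Dimock2022UVStabilityQED3, §4.2.3 Lemma 26 proof (504) p.69 L15–23] -/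
theorem ofGrassmann_quadratic (D : Matrix X X ℂ) :
    (ofGrassmann (quadratic ℂ D) : HGrassmann ℂ (X ⊕ₗ X) h) =
      ∑ x, ∑ y, D x y • (ofGrassmann (psiBar ℂ x * psi ℂ y) : HGrassmann ℂ (X ⊕ₗ X) h) := rfl

/-- `ofGrassmann` is additive (it is the identity). [cite: Dimock2002QED3TorusI, App. B (298) p.62 L1–8] -/
theorem ofGrassmann_sub (F G : GrassmannAlgebra ℂ (X ⊕ₗ X)) :
    (ofGrassmann (F - G) : HGrassmann ℂ (X ⊕ₗ X) h) = ofGrassmann F - ofGrassmann G := rfl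

variable [Fact (0 < h)]

/-- **Analyticity of `t ↦ ⟨Ψ̄_K, D_K(tA)Ψ_K⟩`** in the Banach algebra `(𝒢, ‖·‖_h)`: if every kernel entry `t ↦ D(t)(x,y)`
is complex-differentiable on `U` and continuous on its closure, so is `t ↦ ⟨Ψ̄,D(t)Ψ⟩` (a finite sum of such functions
times fixed vectors) — the reading of «analytic in `A ∈ R̃_K`» along `tA` used by (508).
[cite: Dimock2022UVStabilityQED3, §4.2.3 Lemma 26 proof (508) p.69 L71–84; Theorem 1 p.7 L62–78 («analytic in `A ∈ R̃_k`»)] -/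
theorem diffContOnCl_quadratic (DA : ℂ → Matrix X X ℂ) {U : Set ℂ}
    (hD : ∀ x y, DiffContOnCl ℂ (fun t => DA t x y) U) :
    DiffContOnCl ℂ (fun t => (ofGrassmann (quadratic ℂ (DA t)) : HGrassmann ℂ (X ⊕ₗ X) h)) U := by
  simp only [ofGrassmann_quadratic]
  refine diffContOnCl_finset_sum _ fun x _ => diffContOnCl_finset_sum _ fun y _ => ?_
  exact (hD x y).smul_const _

/-- **(508) PROVED**: `E′_K(Λ_K, A, Ψ_K) = (2πi)⁻¹ ∮_{|t|=R} dt∕(t(t−1)) ⟨Ψ̄_K, D_K(tA)Ψ_K⟩` (the print: `R = e_K^{−3∕4+4ε}`),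
for a kernel family `t ↦ D(t)` (`D(1) = D_K(A)`, `D(0) = D_K(0)`) entrywise complex-differentiable on `|t| < R` and
continuous on `|t| ≤ R`, `R > 1`; the contour integral is taken in the Banach algebra `(𝒢, ‖·‖_h)`.
[cite: Dimock2022UVStabilityQED3, §4.2.3 Lemma 26 proof (508) p.69 L71–84] -/
theorem ePrime_eq_contour (DA : ℂ → Matrix X X ℂ) {R : ℝ} (hR : 1 < R)
    (hD : ∀ x y, DiffContOnCl ℂ (fun t => DA t x y) (ball 0 R)) :
    (ofGrassmann (ePrime (DA 1) (DA 0)) : HGrassmann ℂ (X ⊕ₗ X) h) =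
      (2 * Real.pi * I : ℂ)⁻¹ • ∮ t in C(0, R), (t * (t - 1))⁻¹ •
        (ofGrassmann (quadratic ℂ (DA t)) : HGrassmann ℂ (X ⊕ₗ X) h) := by
  rw [ePrime_def, ofGrassmann_sub]
  exact sub_eq_contourIntegral (f := fun t => (ofGrassmann (quadratic ℂ (DA t)) : HGrassmann ℂ (X ⊕ₗ X) h))
    hR (diffContOnCl_quadratic DA hD)

/-- **(509) from (507)**: with the row-sum decay bound `sup_x Σ_y |D(t)(x,y)| ≤ c` ON THE CIRCLE `|t| = R` («Then (507)
yields the bound»): `‖E′_K‖_h ≤ c·h²·|X|∕(R − 1)`.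
[cite: Dimock2022UVStabilityQED3, §4.2.3 Lemma 26 proof (507)–(509) p.69 L52–96] -/
theorem hNorm_ePrime_le (DA : ℂ → Matrix X X ℂ) {R c : ℝ} (hR : 1 < R)
    (hD : ∀ x y, DiffContOnCl ℂ (fun t => DA t x y) (ball 0 R))
    (h507 : ∀ t ∈ sphere (0 : ℂ) R, ∀ x, ∑ y, ‖DA t x y‖ ≤ c) :
    hNorm h (ePrime (DA 1) (DA 0)) ≤ c * h ^ 2 * Fintype.card X / (R - 1) := by
  have hh : 0 ≤ h := (Fact.out : 0 < h).le
  have key := norm_sub_le_of_sphere (f := fun t => (ofGrassmann (quadratic ℂ (DA t)) : HGrassmann ℂ (X ⊕ₗ X) h))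
    (M := c * h ^ 2 * Fintype.card X) hR (diffContOnCl_quadratic DA hD) (fun t ht => by
      rw [HGrassmann.norm_def]
      exact hNorm_quadratic_le_of_rowsum hh (DA t) (h507 t ht))
  rw [← ofGrassmann_sub, HGrassmann.norm_def] at key
  exact key

/-- **(509) in the printed shape**: radius `R = e_K^{−(3∕4−4ε)} ≥ 2` ⟹ `‖E′_K‖_h ≤ 2c·e_K^{3∕4−4ε}·h²·|X|`
(«`‖E′_K(Λ_K)‖_{h_K} ≤ Ce_K^{3∕4−4ε}h_K²|T⁰_{N−K}|`», the print's `C` = `2c`).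
[cite: Dimock2022UVStabilityQED3, §4.2.3 Lemma 26 proof (509) p.69 L85–96] -/
theorem hNorm_ePrime_le_printed (DA : ℂ → Matrix X X ℂ) {eK ε c : ℝ} (heK : 0 < eK)
    (hR : 2 ≤ eK ^ (-(3 / 4 - 4 * ε)))
    (hD : ∀ x y, DiffContOnCl ℂ (fun t => DA t x y) (ball 0 (eK ^ (-(3 / 4 - 4 * ε)))))
    (h507 : ∀ t ∈ sphere (0 : ℂ) (eK ^ (-(3 / 4 - 4 * ε))), ∀ x, ∑ y, ‖DA t x y‖ ≤ c) :
    hNorm h (ePrime (DA 1) (DA 0)) ≤ 2 * c * eK ^ (3 / 4 - 4 * ε) * h ^ 2 * Fintype.card X := by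
  have hh : 0 ≤ h := (Fact.out : 0 < h).le
  set R := eK ^ (-(3 / 4 - 4 * ε)) with hRdef
  have key := norm_sub_le_two_mul_div (f := fun t => (ofGrassmann (quadratic ℂ (DA t)) : HGrassmann ℂ (X ⊕ₗ X) h))
    (M := c * h ^ 2 * Fintype.card X) hR (diffContOnCl_quadratic DA hD) (fun t ht => by
      rw [HGrassmann.norm_def]
      exact hNorm_quadratic_le_of_rowsum hh (DA t) (h507 t ht))
  rw [← ofGrassmann_sub, HGrassmann.norm_def] at key
  refine key.trans (le_of_eq ?_)
  have hRinv : R⁻¹ = eK ^ (3 / 4 - 4 * ε) := by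
    rw [hRdef, ← Real.rpow_neg heK.le, neg_neg]
  rw [div_eq_mul_inv, hRinv]
  ring

end EPrime

/-! ## §6 (510): `‖E″_K(Λ_K)‖_{C₀⁻¹h_K} ≤ ‖E_K(Λ_K)‖_{h_K} ≤ O(1)e_K^{1∕4−7ε}|T⁰_{N−K}|`, and the bound on `E*_K` -/

section E510

variable {𝕜 : Type*} [RCLike 𝕜] {X : Type*} [LinearOrder X] [Fintype X] {κ : Type*} [LinearOrder κ] [Fintype κ]

/-- **(510), first inequality**: `‖H‖_{(1)} ≤ C₀` (from «`|H#_K(A)f| ≤ C₀‖f‖_∞`») ⟹ `‖E″_K‖_{h_K∕C₀} ≤ ‖E_K(Λ_K)‖_{h_K}`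
— LEMMA 20 with `h′ = h_K∕C₀`. [cite: Dimock2022UVStabilityQED3, §4.2.3 Lemma 26 proof (510) p.69 L97–107] -/
theorem hNorm_eDoublePrime_le (H : Matrix κ (X ⊕ₗ X) 𝕜) (EΛ : GrassmannAlgebra 𝕜 κ) {hK C₀ : ℝ}
    (hhK : 0 ≤ hK) (hC₀ : 0 < C₀) (h327 : opNormOneR H ≤ C₀) :
    hNorm (hK / C₀) (eDoublePrime H EΛ) ≤ hNorm hK EΛ := by
  rw [eDoublePrime_def]
  refine hNorm_substR_le (div_nonneg hhK hC₀.le) H ?_ EΛ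
  calc hK / C₀ * opNormOneR H ≤ hK / C₀ * C₀ :=
        mul_le_mul_of_nonneg_left h327 (div_nonneg hhK hC₀.le)
    _ = hK := div_mul_cancel₀ hK hC₀.ne'

/-- **(510), second inequality** («by our basic estimate (37),(38)»): the polymer expansion `E_K(Λ_K) = Σ_{X∈𝒟} E_K(X)`
with `‖E_K(X)‖_{h_K} ≤ a·w(X)` (`a = e_K^{1∕4−7ε}`, `w(X) = e^{−κd_M(X)}`) and the summed tree decay `Σ_{X∈𝒟}w(X) ≤ K₀T`
gives `‖E_K(Λ_K)‖_{h_K} ≤ a·K₀·T` (`T = |T⁰_{N−K}|`).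
[cite: Dimock2022UVStabilityQED3, §4.2.3 Lemma 26 proof (510) p.69 L97–107; Theorem 1 (37)–(38) p.7 L62–78] -/
theorem hNorm_polymerSum_le {P : Type*} (𝒟 : Finset P) (E : P → GrassmannAlgebra 𝕜 κ) (w : P → ℝ)
    {hK a K₀ T : ℝ} (hhK : 0 ≤ hK) (ha : 0 ≤ a)
    (h38 : ∀ p ∈ 𝒟, hNorm hK (E p) ≤ a * w p) (hsum : ∑ p ∈ 𝒟, w p ≤ K₀ * T) :
    hNorm hK (∑ p ∈ 𝒟, E p) ≤ a * K₀ * T := by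
  refine (hNorm_sum_le hhK _ _).trans ?_
  calc ∑ p ∈ 𝒟, hNorm hK (E p) ≤ ∑ p ∈ 𝒟, a * w p := Finset.sum_le_sum h38
    _ = a * ∑ p ∈ 𝒟, w p := by rw [Finset.mul_sum]
    _ ≤ a * (K₀ * T) := mul_le_mul_of_nonneg_left hsum ha
    _ = a * K₀ * T := by ring

/-- **(510)**: `‖E″_K(Λ_K)‖_{C₀⁻¹h_K} ≤ ‖E_K(Λ_K)‖_{h_K} ≤ e_K^{1∕4−7ε}·K₀·T`.
[cite: Dimock2022UVStabilityQED3, §4.2.3 Lemma 26 proof (510) p.69 L97–107] -/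
theorem ineq510 (H : Matrix κ (X ⊕ₗ X) 𝕜) {P : Type*} (𝒟 : Finset P) (E : P → GrassmannAlgebra 𝕜 κ)
    (w : P → ℝ) {hK C₀ eK ε K₀ T : ℝ} (hhK : 0 ≤ hK) (hC₀ : 0 < C₀) (heK : 0 < eK)
    (h327 : opNormOneR H ≤ C₀)
    (h38 : ∀ p ∈ 𝒟, hNorm hK (E p) ≤ eK ^ (1 / 4 - 7 * ε) * w p) (hsum : ∑ p ∈ 𝒟, w p ≤ K₀ * T) :
    hNorm (hK / C₀) (eDoublePrime H (∑ p ∈ 𝒟, E p)) ≤ eK ^ (1 / 4 - 7 * ε) * K₀ * T :=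
  (hNorm_eDoublePrime_le H _ hhK hC₀ h327).trans
    (hNorm_polymerSum_le 𝒟 E w hhK (Real.rpow_nonneg heK.le _) h38 hsum)

end E510

section EStar

variable {X : Type*} [LinearOrder X] [Fintype X] {κ : Type*} [LinearOrder κ] [Fintype κ]

/-- **«This bound is satisfied by `E′_K(Λ_K)` and hence `E*_K(Λ_K)` as well.»**  With `h_K = e_K^{−1∕4}`, `0 < e_K ≤ 1`,
`ε ≥ 0`, `C₀ ≥ 1`, `|X| ≤ T`: the inputs of (509) (entrywise analyticity of `t ↦ D_K(tA)` on `|t| ≤ e_K^{−(3∕4−4ε)}`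
`≥ 2`, row sums `≤ c` on that circle), of (510) (`‖H‖_{(1)} ≤ C₀`, (38) with weights `w` summing to `≤ K₀T`) give
`‖E*_K‖_{h_K∕C₀} ≤ (2c + K₀)·e_K^{1∕4−7ε}·T` — using `‖·‖_{h_K∕C₀} ≤ ‖·‖_{h_K}` and
`e_K^{3∕4−4ε}h_K² = e_K^{1∕4−4ε} ≤ e_K^{1∕4−7ε}`.
[cite: Dimock2022UVStabilityQED3, §4.2.3 Lemma 26 proof (507)–(510) p.69 L52–110] -/
theorem hNorm_eStar_le (DA : ℂ → Matrix X X ℂ) (H : Matrix κ (X ⊕ₗ X) ℂ) {P : Type*} (𝒟 : Finset P)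
    (E : P → GrassmannAlgebra ℂ κ) (w : P → ℝ) {eK ε c C₀ K₀ T : ℝ}
    (heK : 0 < eK) (heK1 : eK ≤ 1) (hε : 0 ≤ ε) (hc : 0 ≤ c) (hC₀ : 1 ≤ C₀)
    (hT : (Fintype.card X : ℝ) ≤ T)
    (hR : 2 ≤ eK ^ (-(3 / 4 - 4 * ε)))
    (hD : ∀ x y, DiffContOnCl ℂ (fun t => DA t x y) (ball 0 (eK ^ (-(3 / 4 - 4 * ε)))))
    (h507 : ∀ t ∈ sphere (0 : ℂ) (eK ^ (-(3 / 4 - 4 * ε))), ∀ x, ∑ y, ‖DA t x y‖ ≤ c)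
    (h327 : opNormOneR H ≤ C₀)
    (h38 : ∀ p ∈ 𝒟, hNorm (eK ^ (-(1 / 4 : ℝ))) (E p) ≤ eK ^ (1 / 4 - 7 * ε) * w p)
    (hsum : ∑ p ∈ 𝒟, w p ≤ K₀ * T) :
    hNorm (eK ^ (-(1 / 4 : ℝ)) / C₀) (eStar (DA 1) (DA 0) H (∑ p ∈ 𝒟, E p)) ≤
      (2 * c + K₀) * eK ^ (1 / 4 - 7 * ε) * T := by
  set hK : ℝ := eK ^ (-(1 / 4 : ℝ)) with hKdef
  have hhK : 0 < hK := Real.rpow_pos_of_pos heK _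
  have hC₀pos : 0 < C₀ := lt_of_lt_of_le one_pos hC₀
  have hq : 0 ≤ hK / C₀ := div_nonneg hhK.le hC₀pos.le
  haveI : Fact (0 < hK) := ⟨hhK⟩
  -- `E′_K`: (509) at `h_K`, then `‖·‖_{h_K∕C₀} ≤ ‖·‖_{h_K}` and the exponent arithmetic
  have h1 : hNorm (hK / C₀) (ePrime (DA 1) (DA 0)) ≤ 2 * c * eK ^ (1 / 4 - 7 * ε) * T := by
    have hle : hK / C₀ ≤ hK := div_le_self hhK.le hC₀
    refine (hNorm_mono hq hle _).trans ?_
    refine (hNorm_ePrime_le_printed (h := hK) DA heK hR hD h507).trans ?_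
    have hpow : eK ^ (3 / 4 - 4 * ε) * hK ^ 2 = eK ^ (1 / 4 - 4 * ε) := by
      rw [hKdef, ← Real.rpow_natCast, ← Real.rpow_mul heK.le, ← Real.rpow_add heK]
      congr 1
      push_cast
      ring
    have hexp : eK ^ (1 / 4 - 4 * ε) ≤ eK ^ (1 / 4 - 7 * ε) :=
      Real.rpow_le_rpow_of_exponent_ge heK heK1 (by linarith)
    calc 2 * c * eK ^ (3 / 4 - 4 * ε) * hK ^ 2 * (Fintype.card X : ℝ)
        = 2 * c * (eK ^ (3 / 4 - 4 * ε) * hK ^ 2) * (Fintype.card X : ℝ) := by ring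
      _ = 2 * c * eK ^ (1 / 4 - 4 * ε) * (Fintype.card X : ℝ) := by rw [hpow]
      _ ≤ 2 * c * eK ^ (1 / 4 - 7 * ε) * T := by
          refine mul_le_mul (mul_le_mul_of_nonneg_left hexp (by positivity)) hT (by positivity) ?_
          positivity
  -- `E″_K`: (510)
  have h2 : hNorm (hK / C₀) (eDoublePrime H (∑ p ∈ 𝒟, E p)) ≤ eK ^ (1 / 4 - 7 * ε) * K₀ * T :=
    ineq510 H 𝒟 E w hhK.le hC₀pos heK h327 h38 hsum
  -- `E*_K = −E′_K + E″_K`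
  rw [eStar_def]
  refine (hNorm_add_le hq _ _).trans ?_
  rw [hNorm_neg]
  calc hNorm (hK / C₀) (ePrime (DA 1) (DA 0)) + hNorm (hK / C₀) (eDoublePrime H (∑ p ∈ 𝒟, E p))
      ≤ 2 * c * eK ^ (1 / 4 - 7 * ε) * T + eK ^ (1 / 4 - 7 * ε) * K₀ * T := add_le_add h1 h2
    _ = (2 * c + K₀) * eK ^ (1 / 4 - 7 * ε) * T := by ring

end EStar

/-! ## §7 (512)–(513): the change to identity covariance `E**_K = E*_K(Ψ̄_K, C_K(0)Ψ_K)` -/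

section E512

variable {𝕜 : Type*} [RCLike 𝕜] {ι : Type*} [LinearOrder ι] [Fintype ι]

/-- **(512), the mechanism: Gaussian Grassmann integrals are covariant under linear substitutions of the generators** —
`∫ F(BΨ) dμ_Γ = ∫ F dμ_{BΓBᵀ}` for the tree's `∫·dμ_Γ = QuantumLattice.gaussExpect 𝕜 Γ` and substitution
`QED3TorusI.subst B` (the tree's `gaussConv_map`, read through the constant part); with `B` the substitution
«`Ψ̄_K, Ψ_K ↦ Ψ̄_K, C_K(0)Ψ_K`» and `Γ` the identity-covariance pairing this is «we changed to an identity covariance».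
[cite: Dimock2022UVStabilityQED3, §4.2.3 Lemma 26 proof (511)–(512) p.69 L129–137, p.70 L1–4] -/
theorem gaussExpect_subst (Γ B : Matrix ι ι 𝕜) (F : GrassmannAlgebra 𝕜 ι) :
    gaussExpect 𝕜 Γ (subst B F) = gaussExpect 𝕜 (B * Γ * B.transpose) F := by
  rw [subst, gaussExpect_apply, gaussConv_map, constPart_map, gaussExpect_apply, LinearMap.toMatrix'_toLin',
    Matrix.transpose_transpose]

variable {X : Type*} [LinearOrder X] [Fintype X]

/-- **The substitution of (512)** as a matrix on the labels `X ⊕ₗ X` of `(Ψ̄_K, Ψ_K)`: identity on the `Ψ̄`-block, the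
kernel `C` (= `C_K(0)`) on the `Ψ`-block, no mixing. [cite: Dimock2022UVStabilityQED3, §4.2.3 Lemma 26 proof (512) p.70 L1–4] -/
def psiSubst (C : Matrix X X 𝕜) : Matrix (X ⊕ₗ X) (X ⊕ₗ X) 𝕜 :=
  Matrix.of fun a b => Matrix.fromBlocks (1 : Matrix X X 𝕜) 0 0 C (ofLex a) (ofLex b)

omit [LinearOrder X] in
/-- A sum over the labels `X ⊕ₗ X` splits into the `Ψ̄`-labels and the `Ψ`-labels.
[cite: Dimock2002QED3TorusI, App. B p.62 L1–8 («Let `ξ` stand for `(0,α,x)` or `(1,α,x)`»)] -/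
theorem sum_lex_sum {M : Type*} [AddCommMonoid M] (f : X ⊕ₗ X → M) :
    ∑ b, f b = ∑ x, f (toLex (Sum.inl x)) + ∑ y, f (toLex (Sum.inr y)) := by
  rw [← Equiv.sum_comp (toLex : X ⊕ X ≃ X ⊕ₗ X), Fintype.sum_sum_type]

omit [Fintype X] in
/-- `Ψ̄Ψ̄`-block of the substitution: the identity. [cite: Dimock2022UVStabilityQED3, §4.2.3 Lemma 26 proof (512) p.70 L1–4] -/
@[simp] theorem psiSubst_inl_inl (C : Matrix X X 𝕜) (x x' : X) :
    psiSubst C (toLex (Sum.inl x)) (toLex (Sum.inl x')) = (1 : Matrix X X 𝕜) x x' := by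
  simp [psiSubst]

omit [Fintype X] in
/-- `Ψ̄Ψ`-block of the substitution: zero. [cite: Dimock2022UVStabilityQED3, §4.2.3 Lemma 26 proof (512) p.70 L1–4] -/
@[simp] theorem psiSubst_inl_inr (C : Matrix X X 𝕜) (x y : X) :
    psiSubst C (toLex (Sum.inl x)) (toLex (Sum.inr y)) = 0 := by
  simp [psiSubst]

omit [Fintype X] in
/-- `ΨΨ̄`-block of the substitution: zero. [cite: Dimock2022UVStabilityQED3, §4.2.3 Lemma 26 proof (512) p.70 L1–4] -/
@[simp] theorem psiSubst_inr_inl (C : Matrix X X 𝕜) (y x : X) :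
    psiSubst C (toLex (Sum.inr y)) (toLex (Sum.inl x)) = 0 := by
  simp [psiSubst]

omit [Fintype X] in
/-- `ΨΨ`-block of the substitution: the kernel `C`. [cite: Dimock2022UVStabilityQED3, §4.2.3 Lemma 26 proof (512) p.70 L1–4] -/
@[simp] theorem psiSubst_inr_inr (C : Matrix X X 𝕜) (y y' : X) :
    psiSubst C (toLex (Sum.inr y)) (toLex (Sum.inr y')) = C y y' := by
  simp [psiSubst]

/-- **(512) on `Ψ̄_K`**: `Ψ̄_K(x) ↦ Ψ̄_K(x)`. [cite: Dimock2022UVStabilityQED3, §4.2.3 Lemma 26 proof (512) p.70 L1–4] -/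
theorem subst_psiSubst_psiBar (C : Matrix X X 𝕜) (x : X) : subst (psiSubst C) (psiBar 𝕜 x) = psiBar 𝕜 x := by
  erw [psiBar, subst_gen, sum_lex_sum]
  simp only [psiSubst_inl_inl, psiSubst_inl_inr, zero_smul, Finset.sum_const_zero, add_zero]
  rw [Finset.sum_eq_single x]
  · simp only [Matrix.one_apply_eq, one_smul]; congr
  · intro b _ hb; simp [Matrix.one_apply_ne (Ne.symm hb)]
  · intro hx; exact absurd (Finset.mem_univ x) hx

/-- **(512) on `Ψ_K`**: `Ψ_K(y) ↦ (CΨ_K)(y) = Σ_{y′} C(y,y′)Ψ_K(y′)` — «`E**_K(Λ_K, A, Ψ̄_K, Ψ_K) = E*_K(Λ_K, A, Ψ̄_K, C_K(0)Ψ_K)`».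
[cite: Dimock2022UVStabilityQED3, §4.2.3 Lemma 26 proof (512) p.70 L1–4] -/
theorem subst_psiSubst_psi (C : Matrix X X 𝕜) (y : X) :
    subst (psiSubst C) (psi 𝕜 y) = ∑ y', C y y' • psi 𝕜 y' := by
  erw [psi, subst_gen, sum_lex_sum]
  simp only [psiSubst_inr_inl, psiSubst_inr_inr, zero_smul, Finset.sum_const_zero, zero_add]
  refine Finset.sum_congr rfl fun y' _ => ?_
  unfold psi; congr

/-- Row sums of the substitution: `1` on the `Ψ̄`-rows, `Σ_{y′}|C(y,y′)| ≤ ‖C‖_{(1)}` on the `Ψ`-rows.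
[cite: Dimock2022UVStabilityQED3, §4.2.3 Lemma 26 proof (512)–(513) p.70 L1–17] -/
theorem rowsum_psiSubst_le (C : Matrix X X 𝕜) (a : X ⊕ₗ X) :
    ∑ b, ‖psiSubst C a b‖ ≤ max 1 (opNormOne C) := by
  rw [sum_lex_sum]
  obtain ⟨a, rfl⟩ := toLex.surjective a
  rcases a with x | y
  · simp only [psiSubst_inl_inl, psiSubst_inl_inr, norm_zero, Finset.sum_const_zero, add_zero]
    rw [Finset.sum_eq_single x]
    · simp
    · intro b _ hb; simp [Matrix.one_apply_ne (Ne.symm hb)]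
    · intro hx; exact absurd (Finset.mem_univ x) hx
  · simp only [psiSubst_inr_inl, psiSubst_inr_inr, norm_zero, Finset.sum_const_zero, zero_add]
    exact (sum_norm_le_opNormOne C y).trans (le_max_right _ _)

/-- `‖psiSubst C‖_{(1)} ≤ max(1, ‖C‖_{(1)})`. [cite: Dimock2022UVStabilityQED3, §4.2.3 Lemma 26 proof (513) p.70 L5–17] -/
theorem opNormOne_psiSubst_le (C : Matrix X X 𝕜) : opNormOne (psiSubst C) ≤ max 1 (opNormOne C) := by
  rw [opNormOne_eq_opNormOneR]
  exact opNormOneR_le_of_rowsum _ (le_max_of_le_left zero_le_one) (rowsum_psiSubst_le C)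

/-- «As noted in lemma 22 `C_K(0)` has a bounded kernel `|C_K(0,x,y)| ≤ C(Mr_K)³` and then `|C_K(0)f| ≤ C(Mr_K)⁶‖f‖_∞`»:
an entry bound `b` gives `‖psiSubst C‖_{(1)} ≤ max(1, b·|X|)`.
[cite: Dimock2022UVStabilityQED3, §4.2.3 Lemma 26 proof p.70 L5–7; §4.2.1 Lemma 22 proof p.63 L103–105] -/
theorem opNormOne_psiSubst_le_of_kernel (C : Matrix X X 𝕜) {b : ℝ} (hb : 0 ≤ b) (hC : ∀ x y, ‖C x y‖ ≤ b) :
    opNormOne (psiSubst C) ≤ max 1 (b * Fintype.card X) :=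
  (opNormOne_psiSubst_le C).trans (max_le_max le_rfl
    (by rw [opNormOne_eq_opNormOneR]; exact opNormOneR_le_of_entry_le C hb hC))

/-- **(513), first two inequalities**: `h₁‖B‖_{(1)} ≤ h′ ≤ h_q` ⟹ `‖E*(BΨ)‖_{h₁} ≤ ‖E*‖_{h′} ≤ ‖E*‖_{h_q}` — LEMMA 20
and monotonicity («`‖E**_K‖₁ ≤ ‖E*_K‖_{C(Mr_K)⁶} ≤ ‖E*_K‖_{C₀⁻¹h_K}`»: `h₁ = 1`, `h′ = C(Mr_K)⁶`, `h_q = C₀⁻¹h_K`).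
[cite: Dimock2022UVStabilityQED3, §4.2.3 Lemma 26 proof (513) p.70 L5–17] -/
theorem ineq513 (B : Matrix ι ι 𝕜) (Estar : GrassmannAlgebra 𝕜 ι) {h₁ h' hq : ℝ} (hh₁ : 0 ≤ h₁)
    (hB : h₁ * opNormOne B ≤ h') (hle : h' ≤ hq) :
    hNorm h₁ (subst B Estar) ≤ hNorm hq Estar := by
  have hh' : 0 ≤ h' := le_trans (mul_nonneg hh₁ (opNormOne_nonneg B)) hB
  exact (hNorm_subst_le hh₁ B hB Estar).trans (hNorm_mono hh' hle Estar)

end E512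

/-! ## §8 LEMMA 26 (503) assembled from (504)–(514) -/

section Assembly

variable {𝕜 : Type*} [RCLike 𝕜] {ι : Type*} [LinearOrder ι] [Fintype ι] {h₁ : ℝ} [Fact (0 < h₁)]

/-- The substitution `F ↦ F(BΨ)` regarded on the Banach algebra `(𝒢, ‖·‖_{h₁})` (same map as `QED3TorusI.subst B`).
[cite: Dimock2022UVStabilityQED3, §4.2.3 Lemma 26 proof (512) p.70 L1–4] -/
def substH (B : Matrix ι ι 𝕜) : HGrassmann 𝕜 ι h₁ →ₐ[𝕜] HGrassmann 𝕜 ι h₁ := subst B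

omit [Fact (0 < h₁)] in
/-- `substH` is `subst` (the norm forgotten). [cite: Dimock2022UVStabilityQED3, §4.2.3 Lemma 26 proof (512) p.70 L1–4] -/
theorem substH_apply (B : Matrix ι ι 𝕜) (F : HGrassmann 𝕜 ι h₁) :
    toGrassmann (substH B F) = subst B (toGrassmann F) := rfl

/-- The substitution is continuous on `(𝒢, ‖·‖_{h₁})` (a linear map of a finite-dimensional normed space).
[cite: Dimock2022UVStabilityQED3, §4.2.3 Lemma 26 proof (512) p.70 L1–4] -/
theorem continuous_substH (B : Matrix ι ι 𝕜) : Continuous (substH (h₁ := h₁) B) :=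
  LinearMap.continuous_of_finiteDimensional (substH (h₁ := h₁) B).toLinearMap

/-- **The substitution commutes with the exponential**: `(e^{E})(BΨ) = e^{E(BΨ)}` for the Banach-algebra exponential
(a continuous algebra homomorphism commutes with `exp`). [cite: Dimock2022UVStabilityQED3, §4.2.3 Lemma 26 proof (511)–(512) p.69 L129–137, p.70 L1–4] -/
theorem substH_exp (B : Matrix ι ι 𝕜) (E : HGrassmann 𝕜 ι h₁) :
    substH B (NormedSpace.exp E) = NormedSpace.exp (substH B E) :=
  NormedSpace.map_exp_of_mem_ball (𝕂 := 𝕜) (substH B) (continuous_substH B) E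
    ((NormedSpace.expSeries_radius_eq_top 𝕜 (HGrassmann 𝕜 ι h₁)).symm ▸ edist_lt_top _ _)

/-- **(512)**: `∫ e^{E*} dμ_{BΓBᵀ} = ∫ e^{E**} dμ_Γ` with `E** = E*(BΨ)` — «in the last step we changed to an identity
covariance defining `E**_K = E*_K(Ψ̄_K, C_K(0)Ψ_K)`» (`Γ` = the identity-covariance pairing, `B = psiSubst C_K(0)`,
`BΓBᵀ` = the `C_K(0)`-covariance pairing). [cite: Dimock2022UVStabilityQED3, §4.2.3 Lemma 26 proof (511)–(512) p.69 L129–137, p.70 L1–4] -/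
theorem eq512 (Γ B : Matrix ι ι 𝕜) (E : HGrassmann 𝕜 ι h₁) :
    gaussExpect 𝕜 (B * Γ * B.transpose) (toGrassmann (NormedSpace.exp E)) =
      gaussExpect 𝕜 Γ (toGrassmann (NormedSpace.exp (substH B E))) := by
  rw [← gaussExpect_subst, ← substH_apply, substH_exp]

/-- **LEMMA 26 from (513)** (abstract integral): for any additive functional `μ` on `(𝒢, ‖·‖_{h₁})` with `|μF| ≤ ‖F‖_{h₁}`
and `μ1 = 1` (the `∫·dμ_I` of «`|∫f(Ψ)dμ_I(Ψ)| ≤ ‖f‖₁`», p.61 L57), a substitution `B` with `h₁‖B‖_{(1)} ≤ h′ ≤ h_q`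
and `E*` with `‖E*‖_{h_q} ≤ c′e_K^{1∕4−7ε}T`, `c′e_K^{1∕4−7ε}T ≤ 1`, `e·c′·T·e_K^{ε} ≤ 1`:
`|μ(e^{E*(BΨ)}) − 1| ≤ e_K^{1∕4−8ε}` — (513) fed into the tree's `lemma26_closing_grassmann` ((511), (514)).
[cite: Dimock2022UVStabilityQED3, §4.2.3 Lemma 26 (503) p.69 L1–3; proof (511)–(514) p.69 L111 – p.70 L35] -/
theorem lemma26_of_513 (μ : HGrassmann 𝕜 ι h₁ →+ 𝕜) (hμ : ∀ F, ‖μ F‖ ≤ ‖F‖) (hμ1 : μ 1 = 1)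
    (B : Matrix ι ι 𝕜) (Estar : GrassmannAlgebra 𝕜 ι) {h' hq c' T eK ε : ℝ}
    (heK : 0 < eK) (hc' : 0 ≤ c') (hT : 0 ≤ T)
    (hB : h₁ * opNormOne B ≤ h') (hle : h' ≤ hq)
    (hEstar : hNorm hq Estar ≤ c' * eK ^ (1 / 4 - 7 * ε) * T)
    (hprod : c' * eK ^ (1 / 4 - 7 * ε) * T ≤ 1) (hlog : Real.exp 1 * c' * T * eK ^ ε ≤ 1) :
    ‖μ (NormedSpace.exp (ofGrassmann (subst B Estar) : HGrassmann 𝕜 ι h₁)) - 1‖ ≤ eK ^ (1 / 4 - 8 * ε) := by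
  refine lemma26_closing_grassmann μ hμ hμ1 heK hc' hT ?_ hprod hlog
  rw [HGrassmann.norm_def]
  exact (ineq513 B Estar (Fact.out : 0 < h₁).le hB hle).trans hEstar

end Assembly

section Final

variable {X : Type*} [LinearOrder X] [Fintype X] {κ : Type*} [LinearOrder κ] [Fintype κ] {h₁ : ℝ} [Fact (0 < h₁)]

/-- **LEMMA 26 (503), everything chained**: `|∫e^{E*_K(Λ_K)}dμ_{C} − 1| ≤ e_K^{1∕4−8ε}`, where `E*_K = −E′_K + E″_K` is
built by (504) from the kernel family `t ↦ D(t) = D_K(tA)`, the substitution `H = H#_K(A)` and the activities `E_K(X)`,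
`X ∈ 𝒟`, and `∫·dμ_C = gaussExpect (BΓBᵀ)` with `B = psiSubst C` (`C = C_K(0)`) and `Γ` an identity-covariance pairing
— FROM: `0 < e_K ≤ 1`, `ε ≥ 0`, `C₀ ≥ 1`, `|X| ≤ T`; the radius `e_K^{−(3∕4−4ε)} ≥ 2`; entrywise analyticity of `D(t)`
on that closed disc and the decay row-sum bound (507) `≤ c` on its boundary circle; (327) `‖H‖_{(1)} ≤ C₀`; (38)
`‖E_K(X)‖_{h_K} ≤ e_K^{1∕4−7ε}w(X)` with `Σ_{X∈𝒟}w(X) ≤ K₀T`, `h_K = e_K^{−1∕4}`; D12 LEMMA 21's hypothesis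
`√‖Γ‖₍₂₎ ≤ h₁` (charge-respecting `Γ`); the substitution bound of (513) `h₁‖B‖_{(1)} ≤ h′ ≤ h_K∕C₀`; and the two printed
smallness conditions with `O(1) = 2c + K₀`.
[cite: Dimock2022UVStabilityQED3, §4.2.3 Lemma 26 (503) p.69 L1–3; proof (504)–(514) p.69 L4 – p.70 L35] -/
theorem lemma26 (DA : ℂ → Matrix X X ℂ) (H : Matrix κ (X ⊕ₗ X) ℂ) {P : Type*} (𝒟 : Finset P)
    (E : P → GrassmannAlgebra ℂ κ) (w : P → ℝ) (Γ : Matrix (X ⊕ₗ X) (X ⊕ₗ X) ℂ) (q : X ⊕ₗ X → Bool)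
    (C : Matrix X X ℂ) {eK ε c C₀ K₀ T h' : ℝ}
    (heK : 0 < eK) (heK1 : eK ≤ 1) (hε : 0 ≤ ε) (hc : 0 ≤ c) (hC₀ : 1 ≤ C₀) (hK₀ : 0 ≤ K₀)
    (hT : (Fintype.card X : ℝ) ≤ T)
    (hR : 2 ≤ eK ^ (-(3 / 4 - 4 * ε)))
    (hD : ∀ x y, DiffContOnCl ℂ (fun t => DA t x y) (ball 0 (eK ^ (-(3 / 4 - 4 * ε)))))
    (h507 : ∀ t ∈ sphere (0 : ℂ) (eK ^ (-(3 / 4 - 4 * ε))), ∀ x, ∑ y, ‖DA t x y‖ ≤ c)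
    (h327 : opNormOneR H ≤ C₀)
    (h38 : ∀ p ∈ 𝒟, hNorm (eK ^ (-(1 / 4 : ℝ))) (E p) ≤ eK ^ (1 / 4 - 7 * ε) * w p)
    (hsum : ∑ p ∈ 𝒟, w p ≤ K₀ * T)
    (hΓq : ∀ a b, q a = q b → Γ a b = 0) (hΓ : Real.sqrt (twoNorm q (contr ℂ Γ)) ≤ h₁)
    (hB : h₁ * opNormOne (psiSubst C) ≤ h') (hle : h' ≤ eK ^ (-(1 / 4 : ℝ)) / C₀)
    (hprod : (2 * c + K₀) * eK ^ (1 / 4 - 7 * ε) * T ≤ 1)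
    (hlog : Real.exp 1 * (2 * c + K₀) * T * eK ^ ε ≤ 1) :
    ‖gaussExpect ℂ (psiSubst C * Γ * (psiSubst C).transpose)
        (toGrassmann (NormedSpace.exp (ofGrassmann (eStar (DA 1) (DA 0) H (∑ p ∈ 𝒟, E p)) :
          HGrassmann ℂ (X ⊕ₗ X) h₁))) - 1‖ ≤ eK ^ (1 / 4 - 8 * ε) := by
  have hT0 : 0 ≤ T := le_trans (Nat.cast_nonneg _) hT
  rw [eq512]
  have hEstar := hNorm_eStar_le DA H 𝒟 E w heK heK1 hε hc hC₀ hT hR hD h507 h327 h38 hsum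
  exact lemma26_of_513 ((gaussExpect ℂ Γ).toAddMonoidHom : HGrassmann ℂ (X ⊕ₗ X) h₁ →+ ℂ)
    (fun F => norm_gaussExpect_le_hNorm q Γ hΓq hΓ (toGrassmann F)) (gaussExpect_one ℂ Γ)
    (psiSubst C) _ heK (by positivity) hT0 hB hle hEstar hprod hlog

end Final

/-! ## §9 (v1.1) The unit Gaussian `dμ_I`: the identity-covariance pairing, its charge condition and `‖Γ_I‖₍₂₎ ≤ 1` -/

section Unit

variable {𝕜 : Type*} [RCLike 𝕜] {X : Type*} [LinearOrder X] [Fintype X]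

/-- The charge of a fermion label of `X ⊕ₗ X`: `true` on the `Ψ̄`-block, `false` on the `Ψ`-block (the `q` of D12 App. B
(309)–(310): «terms with `n ≠ m` give zero»). [cite: Dimock2002QED3TorusI, App. B (309) p.63 L25–31] -/
def isBar (a : X ⊕ₗ X) : Bool := (ofLex a).isLeft

omit [LinearOrder X] [Fintype X] in
/-- `Ψ̄(x)` is barred. [cite: Dimock2002QED3TorusI, App. B (309) p.63 L25–31] -/
@[simp] theorem isBar_inl (x : X) : isBar (toLex (Sum.inl x) : X ⊕ₗ X) = true := rfl

omit [LinearOrder X] [Fintype X] in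
/-- `Ψ(y)` is unbarred. [cite: Dimock2002QED3TorusI, App. B (309) p.63 L25–31] -/
@[simp] theorem isBar_inr (y : X) : isBar (toLex (Sum.inr y) : X ⊕ₗ X) = false := rfl

/-- **The unit pairing `dμ_I`** («we changed to an identity covariance», (511)–(512)): the antisymmetric pairing matrix
on `X ⊕ₗ X` with `Ψ̄Ψ`-block `1`, `ΨΨ̄`-block `−1` and no equal-charge pairing, whose two-point function is
`∫Ψ(y)Ψ̄(x̄)dμ_I = δ(y,x̄)` (`contr_unitPairing_inr`). [cite: Dimock2022UVStabilityQED3, §4.2.3 Lemma 26 proof (511)–(512) p.69 L129–137, p.70 L1–4] -/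
def unitPairing : Matrix (X ⊕ₗ X) (X ⊕ₗ X) 𝕜 :=
  Matrix.of fun a b => Matrix.fromBlocks (0 : Matrix X X 𝕜) 1 (-1) 0 (ofLex a) (ofLex b)

omit [Fintype X] in
/-- `Ψ̄Ψ̄`-block: `0`. [cite: Dimock2022UVStabilityQED3, §4.2.3 Lemma 26 proof (512) p.70 L1–4] -/
@[simp] theorem unitPairing_inl_inl (x x' : X) :
    unitPairing (𝕜 := 𝕜) (toLex (Sum.inl x)) (toLex (Sum.inl x')) = 0 := by simp [unitPairing]

omit [Fintype X] in
/-- `ΨΨ`-block: `0`. [cite: Dimock2022UVStabilityQED3, §4.2.3 Lemma 26 proof (512) p.70 L1–4] -/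
@[simp] theorem unitPairing_inr_inr (y y' : X) :
    unitPairing (𝕜 := 𝕜) (toLex (Sum.inr y)) (toLex (Sum.inr y')) = 0 := by simp [unitPairing]

omit [Fintype X] in
/-- `Ψ̄Ψ`-block: the identity. [cite: Dimock2022UVStabilityQED3, §4.2.3 Lemma 26 proof (512) p.70 L1–4] -/
@[simp] theorem unitPairing_inl_inr (x y : X) :
    unitPairing (𝕜 := 𝕜) (toLex (Sum.inl x)) (toLex (Sum.inr y)) = (1 : Matrix X X 𝕜) x y := by simp [unitPairing]

omit [Fintype X] in
/-- `ΨΨ̄`-block: minus the identity (antisymmetry). [cite: Dimock2022UVStabilityQED3, §4.2.3 Lemma 26 proof (512) p.70 L1–4] -/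
@[simp] theorem unitPairing_inr_inl (y x : X) :
    unitPairing (𝕜 := 𝕜) (toLex (Sum.inr y)) (toLex (Sum.inl x)) = -(1 : Matrix X X 𝕜) y x := by
  simp [unitPairing]

omit [Fintype X] in
/-- **The unit pairing is charged**: labels of equal charge are not paired (D12 LEMMA 21's hypothesis `hC`).
[cite: Dimock2002QED3TorusI, App. B (309) p.63 L25–31 («Terms with `n ≠ m` give zero»)] -/
theorem unitPairing_charge (a b : X ⊕ₗ X) (h : isBar a = isBar b) : unitPairing (𝕜 := 𝕜) a b = 0 := by
  obtain ⟨a, rfl⟩ := toLex.surjective a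
  obtain ⟨b, rfl⟩ := toLex.surjective b
  rcases a with x | y <;> rcases b with x' | y'
  · simp
  · simp at h
  · simp at h
  · simp

omit [LinearOrder X] [Fintype X] in
/-- `½·(1 + 1) = 1` for the tree's two-point-function normalization `½(C(Y,X) − C(X,Y))`.
[cite: Dimock2002QED3TorusI, App. B (309) p.63 L25–31] -/
theorem half_smul_one_mul_two : ((1 / 2 : ℚ) • (1 : 𝕜)) * (1 + 1) = 1 := by
  rw [Rat.smul_one_eq_cast]; push_cast; ring

omit [Fintype X] in
/-- **The two-point function of `dμ_I`** on a `Ψ`-row: `∫Ψ(y)Ψ̄(x̄)dμ_I = δ(y,x̄)` and `∫Ψ(y)Ψ(y′)dμ_I = 0` (the tree's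
`contr`). [cite: Dimock2022UVStabilityQED3, §4.2.3 Lemma 26 proof (511)–(512) p.69 L129 – p.70 L4; Dimock2002QED3TorusI, App. B (309) p.63 L25–31] -/
theorem contr_unitPairing_inr [Fintype X] (y : X) (b : X ⊕ₗ X) :
    contr 𝕜 (unitPairing (𝕜 := 𝕜) (X := X)) (toLex (Sum.inr y)) b
      = if b = toLex (Sum.inl y) then 1 else 0 := by
  obtain ⟨b, rfl⟩ := toLex.surjective b
  rw [contr_apply]
  rcases b with x | y'
  · simp only [unitPairing_inl_inr, unitPairing_inr_inl, sub_neg_eq_add, EmbeddingLike.apply_eq_iff_eq]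
    by_cases hxy : x = y
    · subst hxy
      simp only [Matrix.one_apply_eq, if_true]
      exact half_smul_one_mul_two
    · rw [Matrix.one_apply_ne hxy, Matrix.one_apply_ne (Ne.symm hxy), add_zero, mul_zero, if_neg]
      intro h; exact hxy (Sum.inl_injective h)
  · simp

/-- Each `Ψ`-row of the two-point function of `dμ_I` has `Σ_b|Γ_I(y,b)|² = 1` — the row sums of (310).
[cite: Dimock2002QED3TorusI, App. B (310) p.63 L33–36] -/
theorem sum_sq_contr_unitPairing_inr (y : X) :
    ∑ b, ‖contr 𝕜 (unitPairing (𝕜 := 𝕜) (X := X)) (toLex (Sum.inr y)) b‖ ^ 2 = 1 := by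
  simp_rw [contr_unitPairing_inr]
  rw [Finset.sum_eq_single (toLex (Sum.inl y))]
  · simp
  · intro b _ hb; simp [hb]
  · intro h; exact absurd (Finset.mem_univ _) h

/-- `‖Γ_I‖²₍₂₎ ≤ 1` (`= 1` for nonempty `X`). [cite: Dimock2002QED3TorusI, App. B (310) p.63 L33–36] -/
theorem twoNormSq_unitPairing_le : twoNormSq isBar (contr 𝕜 (unitPairing (𝕜 := 𝕜) (X := X))) ≤ 1 := by
  unfold twoNormSq
  rcases isEmpty_or_nonempty {a : X ⊕ₗ X // isBar a = false} with h | h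
  · simp
  · refine ciSup_le fun a => ?_
    obtain ⟨a, ha⟩ := a
    obtain ⟨a, rfl⟩ := toLex.surjective a
    rcases a with x | y
    · simp at ha
    · exact (sum_sq_contr_unitPairing_inr (𝕜 := 𝕜) y).le

/-- **`√‖Γ_I‖₍₂₎ ≤ 1`**: D12 LEMMA 21 applies to `dμ_I` with `h = 1` — «In general on a unit lattice `|∫f(Ψ)dμ_I(Ψ)| ≤
‖f‖₁`». [cite: Dimock2022UVStabilityQED3, §4.2.1 p.61 L57; Dimock2002QED3TorusI, App. B Lemma 21 (311) p.64 L1–3] -/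
theorem sqrt_twoNorm_unitPairing_le_one :
    Real.sqrt (twoNorm isBar (contr 𝕜 (unitPairing (𝕜 := 𝕜) (X := X)))) ≤ 1 := by
  rw [Real.sqrt_le_one]
  unfold twoNorm
  rw [Real.sqrt_le_one]
  exact twoNormSq_unitPairing_le

end Unit

section FinalUnit

variable {X : Type*} [LinearOrder X] [Fintype X] {κ : Type*} [LinearOrder κ] [Fintype κ]

/-- **LEMMA 26 (503) with the unit Gaussian `dμ_I` and `‖·‖₁` as printed**: `lemma26` with `Γ = unitPairing` (so that
«`∫·dμ_{C_K(0)}`» = `gaussExpect (BΓ_IBᵀ)`, `B = psiSubst C_K(0)`, by (512)) and `h₁ = 1`; the charge condition and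
`√‖Γ_I‖₍₂₎ ≤ 1` are now theorems (`unitPairing_charge`, `sqrt_twoNorm_unitPairing_le_one`), the remaining hypotheses are
the analytic∕decay∕polymer∕kernel inputs (507), (38), (327), «`C(Mr_K)⁶ ≤ C₀⁻¹h_K`» and the two printed smallness
conditions.  (`[Fact ((0:ℝ) < 1)]` is the trivially true instance making `(𝒢, ‖·‖₁)` a normed algebra.)
[cite: Dimock2022UVStabilityQED3, §4.2.3 Lemma 26 (503) p.69 L1–3; proof (504)–(514) p.69 L4 – p.70 L35] -/
theorem lemma26_unit [Fact ((0:ℝ) < 1)] (DA : ℂ → Matrix X X ℂ) (H : Matrix κ (X ⊕ₗ X) ℂ) {P : Type*}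
    (𝒟 : Finset P) (E : P → GrassmannAlgebra ℂ κ) (w : P → ℝ) (C : Matrix X X ℂ) {eK ε c C₀ K₀ T h' : ℝ}
    (heK : 0 < eK) (heK1 : eK ≤ 1) (hε : 0 ≤ ε) (hc : 0 ≤ c) (hC₀ : 1 ≤ C₀) (hK₀ : 0 ≤ K₀)
    (hT : (Fintype.card X : ℝ) ≤ T)
    (hR : 2 ≤ eK ^ (-(3 / 4 - 4 * ε)))
    (hD : ∀ x y, DiffContOnCl ℂ (fun t => DA t x y) (ball 0 (eK ^ (-(3 / 4 - 4 * ε)))))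
    (h507 : ∀ t ∈ sphere (0 : ℂ) (eK ^ (-(3 / 4 - 4 * ε))), ∀ x, ∑ y, ‖DA t x y‖ ≤ c)
    (h327 : opNormOneR H ≤ C₀)
    (h38 : ∀ p ∈ 𝒟, hNorm (eK ^ (-(1 / 4 : ℝ))) (E p) ≤ eK ^ (1 / 4 - 7 * ε) * w p)
    (hsum : ∑ p ∈ 𝒟, w p ≤ K₀ * T)
    (hB : opNormOne (psiSubst C) ≤ h') (hle : h' ≤ eK ^ (-(1 / 4 : ℝ)) / C₀)
    (hprod : (2 * c + K₀) * eK ^ (1 / 4 - 7 * ε) * T ≤ 1)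
    (hlog : Real.exp 1 * (2 * c + K₀) * T * eK ^ ε ≤ 1) :
    ‖gaussExpect ℂ (psiSubst C * unitPairing * (psiSubst C).transpose)
        (toGrassmann (NormedSpace.exp (ofGrassmann (eStar (DA 1) (DA 0) H (∑ p ∈ 𝒟, E p)) :
          HGrassmann ℂ (X ⊕ₗ X) 1))) - 1‖ ≤ eK ^ (1 / 4 - 8 * ε) :=
  lemma26 DA H 𝒟 E w unitPairing isBar C heK heK1 hε hc hC₀ hK₀ hT hR hD h507 h327 h38 hsum
    (fun a b hab => unitPairing_charge a b hab) sqrt_twoNorm_unitPairing_le_one (by rw [one_mul]; exact hB) hle hprod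
    hlog

end FinalUnit

/-! ## §10 (v1.1) The row-sum input of (507) from `D_K(A) = b_K − b_K²Q_K(A)S_K(A)Q_K^T(−A)` and the decay of `S_K(A)` -/

section RowSum

variable {𝕜 : Type*} [RCLike 𝕜] {l m n : Type*} [Fintype l] [Fintype m] [Fintype n]

omit [Fintype l] in
/-- Row sums of a product of kernels: `Σ_j|(AB)(i,j)| ≤ (Σ_k|A(i,k)|)·‖B‖_{(1)}`.
[cite: Dimock2022UVStabilityQED3, §4.2.3 Lemma 26 proof p.69 L52–58 («the representation `D_K(A) = b_K − b_K²Q_K(A)S_K(A)Q_K^T(−A)`»)] -/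
theorem rowsum_mul_le (A : Matrix l m 𝕜) (B : Matrix m n 𝕜) (i : l) :
    ∑ j, ‖(A * B) i j‖ ≤ (∑ k, ‖A i k‖) * opNormOneR B := by
  calc ∑ j, ‖(A * B) i j‖ = ∑ j, ‖∑ k, A i k * B k j‖ := by simp only [Matrix.mul_apply]
    _ ≤ ∑ j, ∑ k, ‖A i k‖ * ‖B k j‖ :=
        Finset.sum_le_sum fun j _ => (norm_sum_le _ _).trans (le_of_eq (by simp only [norm_mul]))
    _ = ∑ k, ‖A i k‖ * ∑ j, ‖B k j‖ := by rw [Finset.sum_comm]; simp only [Finset.mul_sum]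
    _ ≤ ∑ k, ‖A i k‖ * opNormOneR B :=
        Finset.sum_le_sum fun k _ => mul_le_mul_of_nonneg_left (sum_norm_le_opNormOneR B k) (norm_nonneg _)
    _ = (∑ k, ‖A i k‖) * opNormOneR B := by rw [Finset.sum_mul]

omit [Fintype m] in
/-- **«Using the decay bounds for `S_K(A)`»**: a kernel with `|S(x,y)| ≤ C·wt(x,y)` and summable decay weight
`Σ_ywt(x,y) ≤ K₀` (e.g. `wt = e^{−γd(x,y)}` and the lattice sum) has `‖S‖_{(1)} ≤ C·K₀`.
[cite: Dimock2022UVStabilityQED3, §4.2.3 Lemma 26 proof (507) p.69 L55–70] -/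
theorem opNormOneR_le_of_decay (S : Matrix m n 𝕜) (wt : m → n → ℝ) {C K₀ : ℝ} (hC : 0 ≤ C) (hK : 0 ≤ K₀)
    (hS : ∀ x y, ‖S x y‖ ≤ C * wt x y) (hwt : ∀ x, ∑ y, wt x y ≤ K₀) : opNormOneR S ≤ C * K₀ := by
  refine opNormOneR_le_of_rowsum S (by positivity) fun x => ?_
  calc ∑ y, ‖S x y‖ ≤ ∑ y, C * wt x y := Finset.sum_le_sum fun y _ => hS x y
    _ = C * ∑ y, wt x y := by rw [Finset.mul_sum]
    _ ≤ C * K₀ := mul_le_mul_of_nonneg_left (hwt x) hC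

variable [DecidableEq l]

/-- **The row sums of `D = b·1 − b²·QSQᵗ`** (the printed representation of `D_K(A)`, `b = b_K`, `Q = Q_K(A)`,
`S = S_K(A)`, `Qᵗ = Q_K^T(−A)`): `Σ_y|D(x,y)| ≤ |b| + |b|²·(Σ_k|Q(x,k)|)·‖S‖_{(1)}·‖Qᵗ‖_{(1)}` — with the decay of `S` this
is the constant `c` of (507). [cite: Dimock2022UVStabilityQED3, §4.2.3 Lemma 26 proof (507) p.69 L52–67] -/
theorem rowsum_rep_le (b : 𝕜) (Q : Matrix l m 𝕜) (S : Matrix m n 𝕜) (Qt : Matrix n l 𝕜) (i : l) :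
    ∑ j, ‖(b • (1 : Matrix l l 𝕜) - b ^ 2 • (Q * S * Qt)) i j‖
      ≤ ‖b‖ + ‖b‖ ^ 2 * ((∑ k, ‖Q i k‖) * opNormOneR S * opNormOneR Qt) := by
  have h1 : ∑ j, ‖(b • (1 : Matrix l l 𝕜)) i j‖ = ‖b‖ := by
    rw [Finset.sum_eq_single i]
    · simp
    · intro j _ hj; simp [Matrix.one_apply_ne (Ne.symm hj)]
    · intro h; exact absurd (Finset.mem_univ i) h
  have h2 : ∑ j, ‖(b ^ 2 • (Q * S * Qt)) i j‖ ≤ ‖b‖ ^ 2 * ((∑ k, ‖Q i k‖) * opNormOneR S * opNormOneR Qt) := by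
    simp only [Matrix.smul_apply, smul_eq_mul, norm_mul, norm_pow, ← Finset.mul_sum]
    refine mul_le_mul_of_nonneg_left ?_ (by positivity)
    refine (rowsum_mul_le (Q * S) Qt i).trans ?_
    exact mul_le_mul_of_nonneg_right (rowsum_mul_le Q S i) (opNormOneR_nonneg Qt)
  calc ∑ j, ‖(b • (1 : Matrix l l 𝕜) - b ^ 2 • (Q * S * Qt)) i j‖
      ≤ ∑ j, (‖(b • (1 : Matrix l l 𝕜)) i j‖ + ‖(b ^ 2 • (Q * S * Qt)) i j‖) :=
        Finset.sum_le_sum fun j _ => by rw [Matrix.sub_apply]; exact norm_sub_le _ _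
    _ = ∑ j, ‖(b • (1 : Matrix l l 𝕜)) i j‖ + ∑ j, ‖(b ^ 2 • (Q * S * Qt)) i j‖ := Finset.sum_add_distrib
    _ ≤ ‖b‖ + ‖b‖ ^ 2 * ((∑ k, ‖Q i k‖) * opNormOneR S * opNormOneR Qt) := by rw [h1]; exact add_le_add le_rfl h2

/-- **(507)'s hypothesis `h507` from decay**: if along the circle `|t| = R` the kernel is `D(t) = b·1 − b²·Q(t)S(t)Qᵗ(t)`
with `Σ_k|Q(t)(x,k)| ≤ q₁`, `‖Qᵗ(t)‖_{(1)} ≤ q₂` and `|S(t)(x,y)| ≤ C·wt(x,y)`, `Σ_ywt(x,y) ≤ K₀`, then every row sum of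
`D(t)` is at most `c = |b| + |b|²q₁CK₀q₂` — the shape consumed by `hNorm_ePrime_le`∕`lemma26`.
[cite: Dimock2022UVStabilityQED3, §4.2.3 Lemma 26 proof (507)–(509) p.69 L52–96] -/
theorem h507_of_decay (DA : ℂ → Matrix l l ℂ) (Q : ℂ → Matrix l m ℂ) (S : ℂ → Matrix m n ℂ) (Qt : ℂ → Matrix n l ℂ)
    (b : ℂ) (wt : m → n → ℝ) {R q₁ q₂ C K₀ : ℝ} (hq₁ : 0 ≤ q₁) (hC : 0 ≤ C) (hK : 0 ≤ K₀)
    (hrep : ∀ t ∈ sphere (0 : ℂ) R, DA t = b • (1 : Matrix l l ℂ) - b ^ 2 • (Q t * S t * Qt t))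
    (hQ : ∀ t ∈ sphere (0 : ℂ) R, ∀ x, ∑ k, ‖Q t x k‖ ≤ q₁) (hQt : ∀ t ∈ sphere (0 : ℂ) R, opNormOneR (Qt t) ≤ q₂)
    (hS : ∀ t ∈ sphere (0 : ℂ) R, ∀ x y, ‖S t x y‖ ≤ C * wt x y) (hwt : ∀ x, ∑ y, wt x y ≤ K₀) :
    ∀ t ∈ sphere (0 : ℂ) R, ∀ x, ∑ y, ‖DA t x y‖ ≤ ‖b‖ + ‖b‖ ^ 2 * (q₁ * (C * K₀) * q₂) := by
  intro t ht x
  rw [hrep t ht]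
  refine (rowsum_rep_le b (Q t) (S t) (Qt t) x).trans ?_
  have hSn : opNormOneR (S t) ≤ C * K₀ := opNormOneR_le_of_decay (S t) wt hC hK (hS t ht) hwt
  refine add_le_add le_rfl (mul_le_mul_of_nonneg_left ?_ (by positivity))
  exact mul_le_mul (mul_le_mul (hQ t ht x) hSn (opNormOneR_nonneg _) hq₁) (hQt t ht) (opNormOneR_nonneg _)
    (by positivity)

end RowSum

/-! ## §11 (v1.1) LEMMA 26 feeds LEMMA 27: the second factor of (519) -/

section Lemma27

variable {X : Type*} [LinearOrder X] [Fintype X] {κ : Type*} [LinearOrder κ] [Fintype κ]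

/-- **LEMMA 26 ⟹ the second factor of (519) in LEMMA 27** («The second factor is `1 + O(e_K^{1∕4−8ε})` by lemma 26», p.71
L1–8): with `f₂ = Ξ_K(A_K)∕Z_f(N,0)` = the Gaussian Grassmann integral of `lemma26_unit`, the tree's
`QED3StabilityAssembly.lemma27_assembled` applies with `δ₂ = e_K^{1∕4−8ε}` (`≤ 1` as soon as `ε ≤ 1∕32`): the three-factor
bound (518)∕(519) `‖e^{ε⁰_KT}·f₂·(I − I_ζ)∕I − 1‖ ≤ 4(2e⁶ + e_K^{1∕4−8ε} + e)`.
[cite: Dimock2022UVStabilityQED3, §4.2.4 Lemma 27 (518)–(520) p.70 L69 – p.71 L12; §4.2.3 Lemma 26 (503) p.69 L1–3] -/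
theorem lemma27_with_lemma26 [Fact ((0:ℝ) < 1)] (DA : ℂ → Matrix X X ℂ) (H : Matrix κ (X ⊕ₗ X) ℂ) {P : Type*}
    (𝒟 : Finset P) (E : P → GrassmannAlgebra ℂ κ) (w : P → ℝ) (C : Matrix X X ℂ) {eK ε c C₀ K₀ T h' : ℝ}
    (heK : 0 < eK) (heK1 : eK ≤ 1) (hε : 0 ≤ ε) (hε' : ε ≤ 1 / 32) (hc : 0 ≤ c) (hC₀ : 1 ≤ C₀) (hK₀ : 0 ≤ K₀)
    (hT : (Fintype.card X : ℝ) ≤ T)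
    (hR : 2 ≤ eK ^ (-(3 / 4 - 4 * ε)))
    (hD : ∀ x y, DiffContOnCl ℂ (fun t => DA t x y) (ball 0 (eK ^ (-(3 / 4 - 4 * ε)))))
    (h507 : ∀ t ∈ sphere (0 : ℂ) (eK ^ (-(3 / 4 - 4 * ε))), ∀ x, ∑ y, ‖DA t x y‖ ≤ c)
    (h327 : opNormOneR H ≤ C₀)
    (h38 : ∀ p ∈ 𝒟, hNorm (eK ^ (-(1 / 4 : ℝ))) (E p) ≤ eK ^ (1 / 4 - 7 * ε) * w p)
    (hsum : ∑ p ∈ 𝒟, w p ≤ K₀ * T)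
    (hB : opNormOne (psiSubst C) ≤ h') (hle : h' ≤ eK ^ (-(1 / 4 : ℝ)) / C₀)
    (hprod : (2 * c + K₀) * eK ^ (1 / 4 - 7 * ε) * T ≤ 1)
    (hlog : Real.exp 1 * (2 * c + K₀) * T * eK ^ ε ≤ 1)
    -- the other two factors of (519), as in `QED3StabilityAssembly.lemma27_assembled`
    {ε0 T' e Iζ I : ℝ} (h34 : |ε0| ≤ e ^ 7) (hT' : 0 ≤ T') (he : 0 ≤ e) (he1 : e ≤ 1 / 2) (hsmall : T' * e ≤ 1)
    (hI : 0 < I) (hζ0 : 0 ≤ Iζ) (h523 : Iζ ≤ e * I) :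
    ‖algebraMap ℝ ℂ (Real.exp (ε0 * T')) *
        gaussExpect ℂ (psiSubst C * unitPairing * (psiSubst C).transpose)
          (toGrassmann (NormedSpace.exp (ofGrassmann (eStar (DA 1) (DA 0) H (∑ p ∈ 𝒟, E p)) :
            HGrassmann ℂ (X ⊕ₗ X) 1))) *
        algebraMap ℝ ℂ ((I - Iζ) / I) - 1‖ ≤ 4 * (2 * e ^ 6 + eK ^ (1 / 4 - 8 * ε) + e) := by
  have h26 := lemma26_unit DA H 𝒟 E w C heK heK1 hε hc hC₀ hK₀ hT hR hD h507 h327 h38 hsum hB hle hprod hlog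
  have hδ₂ : eK ^ (1 / 4 - 8 * ε) ≤ 1 := Real.rpow_le_one heK.le heK1 (by linarith)
  exact QED3StabilityAssembly.lemma27_assembled h34 hT' he he1 hsmall h26 hδ₂ hI hζ0 h523

end Lemma27

end QED3SmallFieldFermion

end Literature.MathematicalPhysics.QuantumFieldTheory.Dimock2011to13
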